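import Literature.NumberTheory.EllipticCurves.WeierstrassPlaces
import Literature.NumberTheory.EllipticCurves.IsogenyDegreeKernelProofs
import Literature.NumberTheory.EllipticCurves.IsogenyFactorProofs
import HarnessLib

/-!
# Divisors of rational functions on `E / K̄`: principal divisors, translations, pull-backs

Topic `NumberTheory/EllipticCurves`. First of two files proving the named fact
`WeierstrassCurve.exists_weilPairing` (`Literature.NumberTheory.EllipticCurves.WeilPairing`;
Silverman, *AEC*, III.8, Prop. 8.1 (a)–(d)), one of the three leaves of the decomposition of the
Modularity Theorem in `Literature.NumberTheory.Automorphic.BCDTModularity` (the other two being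
Theorem B of Breuil–Conrad–Diamond–Taylor and Thm. 7.2.4 of Conrad–Diamond–Taylor). Silverman's
construction of the Weil pairing `e_m` (III.§8, p. 93) runs through the divisor theory of `K̄(E)`:
a function `g` with `div(g) = Σ_{R ∈ E[m]} (T' + R) - (R)` (which exists by Cor. III.3.5, the sum
of this divisor being `[m²]T' = O`), the translates `g(X + S)` (`τ_S^* g`, III.3.6), and the
pull-back `f ∘ [m]` (II.§2). This file supplies that divisor theory for an elliptic curve `E = W`
over an arbitrary field `K`, on the geometric points `E(K̄)` (`WeierstrassCurve.geomPoints`) and the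
function field `K̄(E)` (`WeierstrassCurve.geomFunctionField`), on top of the tree's
point-indexed orders `ord_P` (`Literature.NumberTheory.EllipticCurves.WeierstrassPlaces`, with
`deg div (u) = 0`), places `WeierstrassCurve.place` and pull-backs `φ^*`
(`…IsogenyDegreeKernelProofs`), translations `τ_T^*` (`…FunctionFieldTranslation`) and
`[m]^*` (`…IsogenyMulProofs`, `…IsogenyFactorProofs`), and Mathlib's `toClass : E(K̄) → Cl(K̄[E])`.

## Contents (all definitions are real; everything else is proved)

* `Literature.NumberTheory.EllipticCurves.WeilPairingDivisors.exists_eq_pow_of_isEquiv`, `eq_of_isEquiv`: two equivalent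
  `ℤᵐ⁰`-valued valuations of a field, the second having a uniformizer, satisfy `v = w ^ e` with
  `e ≥ 1`; if both have uniformizers they are equal (normalisation of discrete valuations).
* Bridge (`maxIdealAt_eq_pointPrime`, `place_toValuationSubring`, `mem_place_iff`,
  `mem_nonunits_place_iff`): the places `W.place P` of `IsogenyDegreeKernelProofs` are the valuation
  rings of the point-indexed valuations `placeValuation` of `WeierstrassPlaces`;
  `exists_hasValueAt_of_mem_place` (a function regular at an affine `P` has a value there).
* `WeierstrassCurve.PreservesConstants ρ` (`ρ(K̄) ⊆ K̄`), `placeComap ρ hρ Q` (the place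
  `{z : ρ z ∈ K̄[E]_Q}`), **`pointComap ρ Q`** (the point of that place) for a ring automorphism `ρ`
  of `K̄(E)` preserving constants; functoriality (`pointComap_refl/trans/injective`) and
  **`placeValuation_pointComap`: `v_{ρ·Q} = v_Q ∘ ρ`** (via `eq_of_isEquiv`).
* **Translations act on places as on points** (`transRingEquiv T = τ_T^*`):
  `pointComap_transAlgEquiv : τ_T^* · Q = Q + T` for *all* `T, Q` — generic case by the values
  `(τ_T^* z)(Q) = z(Q + T)` of `FunctionFieldTranslation`, `Q = T` by composing two generic
  translations, `Q = -T` (image `O`) because `τ_T^* x = λ² + a₁λ - a₂ - x - a` has a pole at `-T`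
  and the place at infinity is the only place not containing `x` (`Literature.NumberTheory.DiophantineGeometry.WeierstrassPlaces.eq_infPlace`),
  `Q = O` by injectivity, and the `2`-torsion cases by composing with a generic translation — whence
  **`placeValuation_transAlgHom`, `ord_transAlgHom`: `ord_P (τ_T^* u) = ord_{P+T} (u)`**, and
  `ord_prod_transAlgHom` (divisor of a product of translates).
* **Principal divisors** (Silverman, *AEC*, Cor. III.3.5, direction ⇐, and Prop. II.1.2):
  `ord_some_eq_count` (`ord_P` is the multiplicity of `𝔪_P` in the fractional ideal `(u)`),
  `pointFracIdeal`, `mk_pointFracIdeal` (class of `𝔪_P` = `toClass P`),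
  **`exists_ord_eq`**: a finitely supported `D : E(K̄) → ℤ` with `Σ D(P) = 0` and `Σ D(P)•P = O`
  is `div (u)`; `exists_ord_eq_of_pairs` (divisors `Σ_i (P_i) - (Q_i)`);
  `exists_eq_algebraMap_of_ord_nonneg` (no poles ⇒ constant), `exists_eq_smul_of_ord_eq` (same
  divisor ⇒ proportional), **`eq_zero_of_ord_eq_single`** (`(T) - (O)` principal ⇒ `T = O`).
* **Pull-back along an isogeny** (Silverman, *AEC*, II.§2, ramification index `e_φ(P)`):
  `Isogeny.comap_pullbackHom_place_of_rationalRep` (the place at a point of agreement `P` of any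
  rational representation lies above the place at `φ P`),
  `Isogeny.exists_placeValuation_pullbackHom_eq_pow` (`v_P ∘ φ^* = v_{φP} ^ e`, `e ≥ 1`), and for
  `[m]`: **`exists_ord_pullbackHom_zsmul`: `ord_P ([m]^* u) = e · ord_{mP} (u)`** (`mP ≠ O`; in
  fact `e = 1`, which is not needed downstream).

## Part 2 (appended). `[m](x, y) = m (x, y)` on the generic point; `[m]` is unramified

* `genericImage_zsmul`: the generic image `([m]^* x, [m]^* y) ∈ E(K̄(E))` of `[m]` is `m` times
  the generic point (the multiplication formula of `DivisionPolynomialMultiplication` over the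
  field `K̄(E)`); hence `map_pullbackHom_zsmul_genericPoint` and
  **`transAlgHom_pullbackHom_zsmul`: `τ_S^* ∘ [m]^* = [m]^* ∘ τ_{mS}^*`**.
* **`ord_pullbackHom_zsmul`: `ord_P ([m]^* u) = ord_{mP} (u)` for every `P`** (`m ≠ 0` in `K`),
  i.e. `[m]` is unramified (Silverman, *AEC*, Thm. III.4.10(c) for `[m]`), upgrading
  `exists_ord_pullbackHom_zsmul` (`e ≥ 1`) to `e = 1`: for `w` with a simple zero at `P` and no
  other zero or pole on `P + E[m]` (`exists_ord_eq_one_of_fiber`), the norm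
  `∏_{R ∈ E[m]} τ_R^* w` lies in `K̄(E)^{E[m]} = [m]^* K̄(E)` (the tree's
  `Isogeny.pullbackField_zsmul_eq_fixedField`) and has order `1 = e · ord_{mP}(·)` at `P`; the
  fibre over `O` is reached by a generic translation.

## Faithfulness / relation to the printed proofs

`ord_P`, `div`, "principal" are Silverman's (II.§1, II.§3) for the smooth projective model of `E`
(points `E(K̄) ∪ {O}`, see the module docstring of `WeierstrassPlaces`). Cor. III.3.5 is printed
as a consequence of `E ≅ Pic⁰(E)` (Prop. III.3.4); here the same map is Mathlib's
`WeierstrassCurve.Affine.Point.toClass` into the class group of the Dedekind domain `K̄[E]`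
(an injective homomorphism, which is how Mathlib proves the group law), and "`Σ nP (P)` principal"
is read off from "`∏ 𝔪_P^{n_P}` principal" through the dictionary `ord_P = ` multiplicity of `𝔪_P`
(Mathlib's `FractionalIdeal.count`) and `deg div = 0` at `O`. The statement that `τ_T^*` carries the
local ring at `Q + T` to the local ring at `Q` (i.e. `τ_T` is an automorphism of the curve,
III.3.6 with II.§2) is proved here from the chord formula rather than quoted.

## References

* [SilvermanAEC2009] J. H. Silverman, *The Arithmetic of Elliptic Curves*, 2nd ed., GTM 106,
  Springer 2009: II.§1 (`ord_P`, Prop. II.1.2), II.§2 (`φ^*`, `e_φ(P)`), II.§3 (divisors,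
  Prop. II.3.1), III.2.3 (group law), Prop. III.3.4 and **Cor. III.3.5**, III.3.6 (`τ_T`),
  III.§8 p. 93 (the divisor `Σ (T' + R) - (R)`).
* H. Stichtenoth, *Algebraic Function Fields and Codes*, GTM 254, §I.1 (places; the tree's
  `PlaceOver`).

## Design

`noncomputable section`, `open scoped Classical`, universe `u`, `K : Type u`, dot-notation
extensions in `namespace WeierstrassCurve` (next to `geomPoints`, `place`, `transAlgHom`), the
two valuation lemmas in `namespace Literature.WeilPairingDivisors`. Orders are the tree's
`Literature.WeierstrassFunctionField.ord (W.baseChange (AlgebraicClosure K)).toAffine P u` written out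
(no new abbreviation), so that all lemmas of `WeierstrassPlaces` apply verbatim. `pointComap`
takes a junk value (`Q`) when `ρ` does not preserve constants, so that no proof argument clutters
the notation; all lemmas carry the hypothesis.
-/

noncomputable section

open scoped Classical
open scoped Polynomial.Bivariate WithZero nonZeroDivisors
open Polynomial IsDedekindDomain WithZero

universe u

/-! ## Equivalent `ℤᵐ⁰`-valued valuations with uniformizers -/

namespace Literature.NumberTheory.EllipticCurves.WeilPairingDivisors

variable {L : Type*} [Field L]

/-- If `v` is equivalent to `w` (`ℤᵐ⁰`-valued valuations of a field) and `w` takes the value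
`exp (-1)` (has a uniformizer), then `v = w ^ e` for some integer `e ≥ 1` (the ramification index
of `v` over `w`). [folklore] -/
theorem exists_eq_pow_of_isEquiv {v w : Valuation L ℤᵐ⁰} (h : v.IsEquiv w) {π : L}
    (hπ : w π = exp (-1)) : ∃ e : ℕ, 1 ≤ e ∧ ∀ z, v z = w z ^ e := by
  have hπ0 : π ≠ 0 := fun h0 ↦ by
    rw [h0, map_zero] at hπ
    exact exp_ne_zero hπ.symm
  have hvπ0 : v π ≠ 0 := (Valuation.ne_zero_iff v).mpr hπ0
  have hwπ : w π < 1 := by rw [hπ, ← exp_zero, exp_lt_exp]; decide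
  have hvπ : v π < 1 := h.lt_one_iff_lt_one.mpr hwπ
  -- `v π = exp (-e)` with `e ≥ 1`
  set n : ℤ := log (v π) with hn
  have hvπ' : v π = exp n := (exp_log hvπ0).symm
  have hnneg : n < 0 := by
    rwa [hvπ', ← exp_zero, exp_lt_exp] at hvπ
  refine ⟨(-n).toNat, by omega, fun z ↦ ?_⟩
  have he : (((-n).toNat : ℕ) : ℤ) = -n := Int.toNat_of_nonneg (by omega)
  by_cases hz : z = 0
  · subst hz
    rw [map_zero, map_zero, zero_pow (by omega)]
  have hwz0 : w z ≠ 0 := (Valuation.ne_zero_iff w).mpr hz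
  set k : ℤ := log (w z) with hk
  have hwz : w z = exp k := (exp_log hwz0).symm
  -- `w z = w (π ^ (-k))`, hence `v z = v (π ^ (-k))`
  have hwzπ : w z = w (π ^ (-k)) := by
    rw [map_zpow₀, hπ, ← exp_zsmul, smul_eq_mul, hwz]
    congr 1; ring
  have hvzπ : v z = v (π ^ (-k)) := h.eq_iff.mpr hwzπ
  rw [hvzπ, map_zpow₀, hvπ', hwz, ← exp_zsmul, ← exp_nsmul, smul_eq_mul, nsmul_eq_mul, he]
  congr 1; ring

/-- Two equivalent `ℤᵐ⁰`-valued valuations which both take the value `exp (-1)` are equal.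
[folklore] -/
theorem eq_of_isEquiv {v w : Valuation L ℤᵐ⁰} (h : v.IsEquiv w) {π π' : L}
    (hπ : w π = exp (-1)) (hπ' : v π' = exp (-1)) : v = w := by
  obtain ⟨e, he, hvw⟩ := exists_eq_pow_of_isEquiv h hπ
  obtain ⟨e', he', hwv⟩ := exists_eq_pow_of_isEquiv h.symm hπ'
  -- `v π' = (w π')^e = (v π')^(e' e)`, so `e' e = 1`
  have h1 := hvw π'
  rw [hwv π', ← pow_mul, hπ', ← exp_nsmul, exp_inj, nsmul_eq_mul, mul_neg_one, neg_inj] at h1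
  have he1 : e = 1 := by
    have h1' : e' * e = 1 := by exact_mod_cast h1.symm
    exact Nat.eq_one_of_mul_eq_one_left h1'
  ext z
  rw [hvw z, he1, pow_one]

end Literature.NumberTheory.EllipticCurves.WeilPairingDivisors

namespace WeierstrassCurve

open geomPoints Literature.NumberTheory.EllipticCurves.WeierstrassFunctionField Literature.NumberTheory.DiophantineGeometry.AlgFunctionField

variable {K : Type u} [Field K] {W : WeierstrassCurve K}

/-! ## The places of `K̄(E)` and the point-indexed valuations of `WeierstrassPlaces` -/

section Bridge

variable [W.IsElliptic]

/-- The maximal ideal `𝔪_P = ker (r ↦ r(P))` of `IsogenyDegreeKernelProofs` is the height-one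
prime `(x - a, y - b)` of `WeierstrassPlaces`. [folklore] -/
theorem maxIdealAt_eq_pointPrime {a b : AlgebraicClosure K}
    (h : (W.baseChange (AlgebraicClosure K)).toAffine.Nonsingular a b) :
    maxIdealAt h = pointPrime h.left := by
  refine HeightOneSpectrum.ext (Ideal.ext fun r ↦ ?_)
  rw [mem_maxIdealAt_iff, pointPrime_asIdeal, mem_pointIdeal_iff h.left]
  obtain ⟨p, rfl⟩ := AdjoinRoot.mk_surjective r
  change evalAt h (Affine.CoordinateRing.mk _ p) = 0 ↔
    pointEval h.left (Affine.CoordinateRing.mk _ p) = 0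
  rw [evalAt_mk, pointEval_mk]

/-- The valuation ring of the place of `K̄(E)` at `P` (`WeierstrassCurve.place`) is the valuation
ring of the point-indexed valuation `v_P` of `WeierstrassPlaces`. [folklore] -/
theorem place_toValuationSubring (P : W.geomPoints) :
    (W.place P).toValuationSubring =
      (placeValuation (W.baseChange (AlgebraicClosure K)).toAffine P).valuationSubring := by
  cases P with
  | zero => rfl
  | some a b h =>
    rw [place_some, placeValuation_some, ← maxIdealAt_eq_pointPrime h]
    rfl

/-- `u` is regular at `P` (lies in the local ring `K̄[E]_P`) iff `v_P(u) ≤ 1`. [folklore] -/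
theorem mem_place_iff (P : W.geomPoints) (u : W.geomFunctionField) :
    u ∈ (W.place P).toValuationSubring ↔
      placeValuation (W.baseChange (AlgebraicClosure K)).toAffine P u ≤ 1 := by
  rw [place_toValuationSubring]; exact Valuation.mem_valuationSubring_iff _ _

/-- `u` vanishes at `P` (is a non-unit of `K̄[E]_P`) iff `v_P(u) < 1`. [folklore] -/
theorem mem_nonunits_place_iff (P : W.geomPoints) (u : W.geomFunctionField) :
    u ∈ (W.place P).toValuationSubring.nonunits ↔
      placeValuation (W.baseChange (AlgebraicClosure K)).toAffine P u < 1 := by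
  rw [ValuationSubring.mem_nonunits_iff, place_toValuationSubring]
  exact (Valuation.isEquiv_valuation_valuationSubring _).lt_one_iff_lt_one.symm

end Bridge

section Valuations

variable [W.IsElliptic]

/-- Constants have valuation `≤ 1` at every point. [folklore] -/
theorem placeValuation_algebraMap_le_one' (P : W.geomPoints) (c : AlgebraicClosure K) :
    placeValuation (W.baseChange (AlgebraicClosure K)).toAffine P (algebraMap (AlgebraicClosure K) W.geomFunctionField c) ≤ 1 := by
  by_cases hc : c = 0
  · simp [hc]
  · exact (placeValuation_algebraMap P hc).le

/-- Every `v_P` takes the value `exp (-1)` (has a uniformizer). [folklore] -/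
theorem exists_placeValuation_eq_exp_neg_one (P : W.geomPoints) :
    ∃ π : W.geomFunctionField, placeValuation (W.baseChange (AlgebraicClosure K)).toAffine P π = exp (-1) := by
  cases P with
  | zero => exact Literature.NumberTheory.DiophantineGeometry.WeierstrassPlaceAtInfinity.exists_infValuationF_eq_exp_neg_one _
  | some a b h =>
    obtain ⟨π, hπ⟩ := (pointPrime h.left).valuation_exists_uniformizer
      (W.baseChange (AlgebraicClosure K)).toAffine.FunctionField
    exact ⟨π, by rw [placeValuation_some, hπ]⟩

/-- Every `v_P` is a non-trivial valuation. [folklore] -/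
theorem isNontrivial_placeValuation (P : W.geomPoints) : (placeValuation (W.baseChange (AlgebraicClosure K)).toAffine P).IsNontrivial := by
  obtain ⟨u, hu, h1⟩ := exists_placeValuation_ne_one (V := (W.baseChange (AlgebraicClosure K)).toAffine) P
  exact ⟨u, (Valuation.ne_zero_iff _).mpr hu, h1⟩

omit [W.IsElliptic] in
/-- A regular function `r ∈ K̄[E]` has the value `r(P)` at the affine point `P` (in the sense of
`HasValueAt`). [folklore] -/
theorem hasValueAt_algebraMap_geomCoordRing {a b : AlgebraicClosure K}
    (h : (W.baseChange (AlgebraicClosure K)).toAffine.Nonsingular a b) (r : W.geomCoordRing) :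
    W.HasValueAt (algebraMap W.geomCoordRing W.geomFunctionField r) (.some a b h) (evalAt h r) := by
  obtain ⟨p, rfl⟩ := AdjoinRoot.mk_surjective r
  set e := Polynomial.Bivariate.equivMvPolynomial (AlgebraicClosure K)
  have hr : algebraMap W.geomCoordRing W.geomFunctionField (AdjoinRoot.mk _ p) =
      W.evalGeneric (e p) := by
    change _ = algebraMap W.geomCoordRing W.geomFunctionField
      (Affine.CoordinateRing.mk (W.baseChange (AlgebraicClosure K)).toAffine (e.symm (e p)))
    rw [e.symm_apply_apply]
  rw [hr]
  refine (hasValueAt_evalGeneric (W := W) (e p) _).congr rfl ?_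
  rw [xy_some, ← evalAt_mk_equivMvPolynomial_symm h (e p), e.symm_apply_apply]

/-- A function regular at the affine point `P` (an element of `K̄[E]_P`) has a value there.
[folklore] -/
theorem exists_hasValueAt_of_mem_place {P : W.geomPoints} (hP : P ≠ 0) {z : W.geomFunctionField}
    (hz : z ∈ (W.place P).toValuationSubring) : ∃ c, W.HasValueAt z P c := by
  obtain ⟨a, b, h, rfl⟩ := geomPoints.exists_eq_some hP
  rw [place_some, PlaceOver.mem_ofPrime_iff] at hz
  obtain ⟨n, d, hnd⟩ := (maxIdealAt h).exists_primeCompl_mul_eq_of_integer z hz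
  have hd : evalAt h (d : W.geomCoordRing) ≠ 0 := fun h0 ↦ d.2 ((mem_maxIdealAt_iff h _).mpr h0)
  have hvn := hasValueAt_algebraMap_geomCoordRing h n
  have hvd := hasValueAt_algebraMap_geomCoordRing h (d : W.geomCoordRing)
  have hP0 : (Affine.Point.some a b h : W.geomPoints) ≠ 0 := Affine.Point.some_ne_zero _
  have hd0 : algebraMap W.geomCoordRing W.geomFunctionField d ≠ 0 := hvd.ne_zero hP0 hd
  have hz' : z = algebraMap W.geomCoordRing W.geomFunctionField n /
      algebraMap W.geomCoordRing W.geomFunctionField d := by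
    rw [eq_div_iff hd0, hnd]
  exact ⟨_, hz' ▸ hvn.div hP0 hvd hd⟩

end Valuations

/-! ## Transport of places along ring automorphisms of `K̄(E)` preserving `K̄` -/

section Comap

variable [W.IsElliptic]

variable (W) in
/-- A ring endomorphism `ρ` of `K̄(E)` *preserves constants* if `ρ(K̄) ⊆ K̄` (e.g. a `K̄`-algebra
endomorphism such as `τ_T^*` or `φ^*`, or the coefficientwise action of `σ ∈ Γ_K`). [folklore] -/
def PreservesConstants (ρ : W.geomFunctionField →+* W.geomFunctionField) : Prop :=
  ∀ c : AlgebraicClosure K, ∃ c' : AlgebraicClosure K,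
    ρ (algebraMap (AlgebraicClosure K) W.geomFunctionField c) =
      algebraMap (AlgebraicClosure K) W.geomFunctionField c'

omit [W.IsElliptic] in
/-- `K̄`-algebra endomorphisms preserve constants. [folklore] -/
theorem preservesConstants_algHom
    (σ : W.geomFunctionField →ₐ[AlgebraicClosure K] W.geomFunctionField) :
    W.PreservesConstants σ :=
  fun c ↦ ⟨c, σ.commutes c⟩

omit [W.IsElliptic] in
/-- `K̄`-algebra automorphisms preserve constants. [folklore] -/
theorem preservesConstants_algEquiv
    (σ : W.geomFunctionField ≃ₐ[AlgebraicClosure K] W.geomFunctionField) :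
    W.PreservesConstants (σ : W.geomFunctionField ≃+* W.geomFunctionField) :=
  fun c ↦ ⟨c, σ.commutes c⟩

omit [W.IsElliptic] in
/-- Composites of constant-preserving endomorphisms preserve constants. [folklore] -/
theorem PreservesConstants.comp {ρ ρ' : W.geomFunctionField →+* W.geomFunctionField}
    (hρ : W.PreservesConstants ρ) (hρ' : W.PreservesConstants ρ') :
    W.PreservesConstants (ρ.comp ρ') := fun c ↦ by
  obtain ⟨c', hc'⟩ := hρ' c
  obtain ⟨c'', hc''⟩ := hρ c'
  exact ⟨c'', by rw [RingHom.comp_apply, hc', hc'']⟩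

/-- `v_Q ∘ ρ` is a non-trivial valuation for a ring automorphism `ρ`. [folklore] -/
theorem isNontrivial_comap (ρ : W.geomFunctionField ≃+* W.geomFunctionField) (Q : W.geomPoints) :
    ((placeValuation (W.baseChange (AlgebraicClosure K)).toAffine Q).comap
      (ρ : W.geomFunctionField →+* W.geomFunctionField)).IsNontrivial := by
  obtain ⟨u, hu0, hu1⟩ := (isNontrivial_placeValuation (W := W) Q).exists_val_nontrivial
  refine ⟨ρ.symm u, ?_, ?_⟩
  · rw [Valuation.comap_apply, RingEquiv.coe_toRingHom, RingEquiv.apply_symm_apply]; exact hu0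
  · rw [Valuation.comap_apply, RingEquiv.coe_toRingHom, RingEquiv.apply_symm_apply]; exact hu1

variable (W) in
/-- The place `{z : ρ z ∈ K̄[E]_Q}` of `K̄(E)/K̄` obtained by pulling back the place at `Q` along a
ring automorphism `ρ` of `K̄(E)` preserving `K̄` (the valuation ring of the valuation `v_Q ∘ ρ`, a
discrete valuation ring containing `K̄`). [folklore] -/
def placeComap (ρ : W.geomFunctionField ≃+* W.geomFunctionField) (hρ : W.PreservesConstants ρ)
    (Q : W.geomPoints) : PlaceOver (AlgebraicClosure K) W.geomFunctionField :=
  haveI := isNontrivial_comap ρ Q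
  { toValuationSubring :=
      ((placeValuation (W.baseChange (AlgebraicClosure K)).toAffine Q).comap
        (ρ : W.geomFunctionField →+* W.geomFunctionField)).valuationSubring
    ne_top := by
      rw [ne_eq, Valuation.valuationSubring_eq_top_iff, not_not]
      infer_instance
    isDVR := inferInstance
    algebraMap_mem := fun c ↦ by
      obtain ⟨c', hc'⟩ := hρ c
      rw [Valuation.mem_valuationSubring_iff, Valuation.comap_apply, hc']
      exact placeValuation_algebraMap_le_one' Q c' }

/-- Membership in the pulled-back place: `z ∈ placeComap ρ Q ↔ ρ z ∈ K̄[E]_Q`. [folklore] -/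
theorem mem_placeComap_iff (ρ : W.geomFunctionField ≃+* W.geomFunctionField)
    (hρ : W.PreservesConstants ρ) (Q : W.geomPoints) (z : W.geomFunctionField) :
    z ∈ (W.placeComap ρ hρ Q).toValuationSubring ↔ ρ z ∈ (W.place Q).toValuationSubring := by
  rw [mem_place_iff]
  exact Valuation.mem_valuationSubring_iff _ _

variable (W) in
/-- **The point `ρ · Q`**: the unique point of `E(K̄)` whose local ring is `{z : ρ z ∈ K̄[E]_Q}`
(every place of `K̄(E)/K̄` is the place of a unique point, `place_surjective`/`place_injective`),
for a ring automorphism `ρ` of `K̄(E)` preserving constants (junk value `Q` otherwise). For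
`ρ = τ_T^*` this is `Q + T` (`pointComap_transAlgEquiv`). [folklore] -/
def pointComap (ρ : W.geomFunctionField ≃+* W.geomFunctionField) (Q : W.geomPoints) :
    W.geomPoints :=
  if hρ : W.PreservesConstants ρ then (place_surjective (W.placeComap ρ hρ Q)).choose else Q

/-- Defining property of `pointComap`. [folklore] -/
theorem place_pointComap {ρ : W.geomFunctionField ≃+* W.geomFunctionField}
    (hρ : W.PreservesConstants ρ) (Q : W.geomPoints) :
    W.place (W.pointComap ρ Q) = W.placeComap ρ hρ Q := by
  rw [pointComap, dif_pos hρ]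
  exact (place_surjective (W.placeComap ρ hρ Q)).choose_spec

/-- `z` is regular at `ρ · Q` iff `ρ z` is regular at `Q`. [folklore] -/
theorem mem_place_pointComap_iff {ρ : W.geomFunctionField ≃+* W.geomFunctionField}
    (hρ : W.PreservesConstants ρ) (Q : W.geomPoints) (z : W.geomFunctionField) :
    z ∈ (W.place (W.pointComap ρ Q)).toValuationSubring ↔ ρ z ∈ (W.place Q).toValuationSubring := by
  rw [place_pointComap hρ, mem_placeComap_iff]

/-- A point whose local ring is contained in `{z : ρ z ∈ K̄[E]_Q}` is `ρ · Q` (a discrete valuation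
ring of `K̄(E)` is a maximal proper subring). [folklore] -/
theorem pointComap_eq_of_le {ρ : W.geomFunctionField ≃+* W.geomFunctionField}
    (hρ : W.PreservesConstants ρ) {Q P : W.geomPoints}
    (h : (W.place P).toValuationSubring ≤ (W.placeComap ρ hρ Q).toValuationSubring) :
    W.pointComap ρ Q = P := by
  apply place_injective
  rw [place_pointComap hρ]
  exact (PlaceOver.ext (ValuationSubring.eq_of_le_of_ne_top _ h (W.placeComap ρ hρ Q).ne_top)).symm

/-- `pointComap` of the identity. [folklore] -/
theorem pointComap_refl (Q : W.geomPoints) :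
    W.pointComap (RingEquiv.refl W.geomFunctionField) Q = Q :=
  pointComap_eq_of_le (preservesConstants_algEquiv AlgEquiv.refl) fun z hz ↦ by
    rw [mem_placeComap_iff]; exact hz

/-- `pointComap` is compatible with composition: `(ρ then ρ') · Q = ρ · (ρ' · Q)`. [folklore] -/
theorem pointComap_trans {ρ ρ' : W.geomFunctionField ≃+* W.geomFunctionField}
    (hρ : W.PreservesConstants ρ) (hρ' : W.PreservesConstants ρ') (Q : W.geomPoints) :
    W.pointComap (ρ.trans ρ') Q = W.pointComap ρ (W.pointComap ρ' Q) :=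
  pointComap_eq_of_le (show W.PreservesConstants (ρ.trans ρ') from hρ'.comp hρ) fun z hz ↦ by
    rw [mem_placeComap_iff, RingEquiv.coe_trans, Function.comp_apply,
      ← mem_place_pointComap_iff hρ', ← mem_place_pointComap_iff hρ]
    exact hz

/-- `pointComap ρ` is injective (it has the inverse `pointComap ρ.symm`). [folklore] -/
theorem pointComap_injective {ρ : W.geomFunctionField ≃+* W.geomFunctionField}
    (hρ : W.PreservesConstants ρ) (hρ' : W.PreservesConstants ρ.symm) :
    Function.Injective (W.pointComap ρ) := by
  intro P Q hPQ
  have h := congrArg (W.pointComap ρ.symm) hPQ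
  rwa [← pointComap_trans hρ' hρ, ← pointComap_trans hρ' hρ, RingEquiv.symm_trans_self,
    pointComap_refl, pointComap_refl] at h

/-- **Transport of valuations**: `v_Q ∘ ρ = v_{ρ · Q}`, i.e. `v_{ρ·Q} (z) = v_Q (ρ z)` (the two
valuations have the same valuation ring, and both take the value `exp (-1)`). [folklore] -/
theorem placeValuation_pointComap {ρ : W.geomFunctionField ≃+* W.geomFunctionField}
    (hρ : W.PreservesConstants ρ) (Q : W.geomPoints) (z : W.geomFunctionField) :
    placeValuation (W.baseChange (AlgebraicClosure K)).toAffine (W.pointComap ρ Q) z =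
      placeValuation (W.baseChange (AlgebraicClosure K)).toAffine Q (ρ z) := by
  have hsub : (placeValuation (W.baseChange (AlgebraicClosure K)).toAffine
      (W.pointComap ρ Q)).valuationSubring =
      ((placeValuation (W.baseChange (AlgebraicClosure K)).toAffine Q).comap
        (ρ : W.geomFunctionField →+* W.geomFunctionField)).valuationSubring := by
    rw [← place_toValuationSubring, place_pointComap hρ]; rfl
  have hequiv := (Valuation.isEquiv_iff_valuationSubring _ _).mpr hsub
  obtain ⟨π, hπ⟩ := exists_placeValuation_eq_exp_neg_one (W := W) Q
  obtain ⟨π', hπ'⟩ := exists_placeValuation_eq_exp_neg_one (W := W) (W.pointComap ρ Q)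
  have hπρ : ((placeValuation (W.baseChange (AlgebraicClosure K)).toAffine Q).comap
      (ρ : W.geomFunctionField →+* W.geomFunctionField)) (ρ.symm π) = exp (-1) := by
    simpa [Valuation.comap_apply] using hπ
  have := Literature.NumberTheory.EllipticCurves.WeilPairingDivisors.eq_of_isEquiv hequiv hπρ hπ'
  rw [this, Valuation.comap_apply]
  rfl

end Comap


/-! ## Translations: `τ_T^*` pulls the place at `Q` back to the place at `Q + T` -/

section Translation

variable [W.IsElliptic]

variable (W) in
/-- `τ_T^*` as a ring automorphism of `K̄(E)` (the tree's `transAlgEquiv`, forgetting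
`K̄`-linearity). [folklore] -/
abbrev transRingEquiv (T : W.geomPoints) : W.geomFunctionField ≃+* W.geomFunctionField :=
  (W.transAlgEquiv T : W.geomFunctionField ≃+* W.geomFunctionField)

/-- `transRingEquiv` acts as `transAlgHom`. [folklore] -/
@[simp] theorem transRingEquiv_apply (T : W.geomPoints) (z : W.geomFunctionField) :
    W.transRingEquiv T z = W.transAlgHom T z :=
  rfl

/-- `τ_T^*` preserves constants. [folklore] -/
theorem preservesConstants_transRingEquiv (T : W.geomPoints) :
    W.PreservesConstants (W.transRingEquiv T) :=
  preservesConstants_algEquiv _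

/-- `τ_{S+T}^* = τ_S^* ∘ τ_T^*` (`transAlgHom_add`), for the ring automorphisms. [folklore] -/
theorem transRingEquiv_add (S T : W.geomPoints) :
    W.transRingEquiv (S + T) = (W.transRingEquiv T).trans (W.transRingEquiv S) := by
  refine RingEquiv.ext fun z ↦ ?_
  simp [transAlgHom_add]

/-- `τ_O^*` is the identity. [folklore] -/
theorem transRingEquiv_zero : W.transRingEquiv 0 = RingEquiv.refl _ := by
  refine RingEquiv.ext fun z ↦ ?_
  simp [transAlgHom_zero]

/-- `(τ_T^*)⁻¹ = τ_{-T}^*`. [folklore] -/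
theorem transRingEquiv_symm (T : W.geomPoints) :
    (W.transRingEquiv T).symm = W.transRingEquiv (-T) := by
  refine RingEquiv.ext fun z ↦ ?_
  rw [RingEquiv.symm_apply_eq, transRingEquiv_apply, transRingEquiv_apply, ← AlgHom.comp_apply,
    ← transAlgHom_add, add_neg_cancel, transAlgHom_zero, AlgHom.id_apply]

/-- `Q ↦ τ_T^* · Q` is injective. [folklore] -/
theorem pointComap_transRingEquiv_injective (T : W.geomPoints) :
    Function.Injective (W.pointComap (W.transRingEquiv T)) :=
  pointComap_injective (preservesConstants_transRingEquiv T)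
    (by rw [transRingEquiv_symm]; exact preservesConstants_transRingEquiv (-T))

/-- `pointComap` along `τ_{S+T}^*` is `pointComap` along `τ_S^*` followed by `pointComap` along
`τ_T^*`. [folklore] -/
theorem pointComap_transAlgEquiv_add (S T Q : W.geomPoints) :
    W.pointComap (W.transRingEquiv (S + T)) Q =
      W.pointComap (W.transRingEquiv T) (W.pointComap (W.transRingEquiv S) Q) := by
  rw [transRingEquiv_add, pointComap_trans (preservesConstants_transRingEquiv T)
    (preservesConstants_transRingEquiv S)]

/-- **Generic case of `τ_T^* · Q = Q + T`** (`Q ≠ O, ±T`): a function regular at `Q + T` pulls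
back under `τ_T^*` to a function regular at `Q` (`(τ_T^* z)(Q) = z(Q + T)`,
`HasValueAt.transAlgHom`), so `K̄[E]_{Q+T} ⊆ {z : τ_T^* z ∈ K̄[E]_Q}`, with equality by maximality
of discrete valuation rings. Silverman, *AEC*, III.3.6 (`τ_T` is an isomorphism of curves, so
`τ_T^*` permutes the local rings). [folklore] -/
theorem pointComap_transAlgEquiv_of_ne {T Q : W.geomPoints} (hQ : Q ≠ 0) (hQT : Q ≠ T)
    (hQT' : Q + T ≠ 0) : W.pointComap (W.transRingEquiv T) Q = Q + T := by
  refine pointComap_eq_of_le (preservesConstants_transRingEquiv T) fun z hz ↦ ?_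
  rw [mem_placeComap_iff, transRingEquiv_apply]
  obtain ⟨c, hc⟩ := exists_hasValueAt_of_mem_place hQT' hz
  exact ((hc.transAlgHom hQ hQT hQT').mem_place hQ).1

/-- `τ_T^* · T = 2T` for `T ≠ O`, `2T ≠ O` (write `τ_T^* = τ_{T-R}^* ∘ τ_R^*` for a point `R`
avoiding finitely many exceptions and use the generic case twice). [folklore] -/
theorem pointComap_transAlgEquiv_self {T : W.geomPoints} (hT : T ≠ 0) (h2T : T + T ≠ 0) :
    W.pointComap (W.transRingEquiv T) T = T + T := by
  -- choose `R ∉ E[2] ∪ {T, -T}`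
  have hfin : ({R : W.geomPoints | (2 : ℤ) • R = 0} ∪ {T, -T}).Finite :=
    ((finite_geomTorsion W two_ne_zero).subset fun R hR ↦
      (mem_torsionPoints_iff _ _ R).mpr hR).union (Set.toFinite _)
  obtain ⟨R, hR, -⟩ := geomPoints.exists_not_mem_of_finite hfin
  simp only [Set.mem_union, Set.mem_setOf_eq, Set.mem_insert_iff, Set.mem_singleton_iff,
    not_or] at hR
  obtain ⟨h2R, hRT, hRT'⟩ := hR
  have hTR0 : T + R ≠ 0 := fun h ↦ hRT' (eq_neg_of_add_eq_zero_right h)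
  have hTR : T + R ≠ T - R := fun h ↦ h2R (by
    rw [sub_eq_add_neg] at h
    have hR : R = -R := add_left_cancel h
    rw [two_zsmul]
    exact eq_neg_iff_add_eq_zero.mp hR)
  have hTR' : T + R + (T - R) ≠ 0 := by
    rwa [show T + R + (T - R) = T + T by abel]
  -- `T = R + (T - R)`: first `τ_R^*`, then `τ_{T-R}^*`
  have hdec : W.transRingEquiv T = W.transRingEquiv (R + (T - R)) := by rw [add_sub_cancel]
  rw [hdec, pointComap_transAlgEquiv_add,
    pointComap_transAlgEquiv_of_ne hT (Ne.symm hRT) hTR0,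
    pointComap_transAlgEquiv_of_ne hTR0 hTR hTR']
  abel

omit [W.IsElliptic] in
/-- The negative of an affine geometric point, in coordinates. [folklore] -/
theorem geomPoints.neg_some {a b : AlgebraicClosure K}
    (h : (W.baseChange (AlgebraicClosure K)).toAffine.Nonsingular a b) :
    (-(Affine.Point.some a b h : W.geomPoints)) =
      Affine.Point.some a _ ((Affine.nonsingular_neg ..).mpr h) :=
  rfl

/-- **`τ_T^* · (-T) = O`** for `T = (a, b) ≠ O` with `2T ≠ O`: the pulled-back place
`{z : τ_T^* z ∈ K̄[E]_{-T}}` does not contain `x`, because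
`τ_T^* x = λ² + a₁ λ - a₂ - x - a` with `λ = (y - b)/(x - a)` has a pole at `-T`
(`y - b` is a unit and `x - a` vanishes at `-T = (a, -b - a₁ a - a₃) ≠ T`), and the only place of
`K̄(E)` not containing `x` is the place at `O` (`Literature.NumberTheory.DiophantineGeometry.WeierstrassPlaces.eq_infPlace`).
Silverman, *AEC*, III.2.3 (chord formula), Prop. III.3.1. [folklore] -/
theorem pointComap_transAlgEquiv_neg {T : W.geomPoints} (hT : T ≠ 0) (h2T : T + T ≠ 0) :
    W.pointComap (W.transRingEquiv T) (-T) = 0 := by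
  obtain ⟨a, b, hab, rfl⟩ := geomPoints.exists_eq_some hT
  apply place_injective
  rw [place_pointComap (preservesConstants_transRingEquiv _), place_zero]
  refine Literature.NumberTheory.DiophantineGeometry.WeierstrassPlaces.eq_infPlace _ ?_
  rw [mem_placeComap_iff, transRingEquiv_apply]
  change W.transAlgHom _ W.genX ∉ _
  -- the chord formula for `τ_T^* x`
  set F := W.geomFunctionField with hF
  have hxa' : W.genX ≠ algebraMap (AlgebraicClosure K) F a := fun h ↦
    transcendental_genX W (h ▸ isAlgebraic_algebraMap a)
  have hab' := (Affine.baseChange_nonsingular (W := W) (f := Algebra.ofId _ F)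
    (FaithfulSMul.algebraMap_injective _ _) a b).mpr hab
  have hsum' : W.genericPoint + W.constPoint (.some a b hab) =
      Affine.Point.some _ _ (Affine.nonsingular_add (nonsingular_genX_genY W) hab'
        fun h ↦ hxa' h.1) := by
    rw [constPoint_some]
    exact Affine.Point.add_of_X_ne hxa'
  have hmap := map_transAlgHom_genericPoint (W := W) (.some a b hab)
  rw [hsum', map_genericPoint] at hmap
  obtain ⟨hx, -⟩ := Affine.Point.some.inj hmap
  have hn : (W.baseChange (AlgebraicClosure K)).toAffine.Nonsingular a
      ((W.baseChange (AlgebraicClosure K)).toAffine.negY a b) := (Affine.nonsingular_neg ..).mpr hab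
  rw [hx]
  change _ ∉ (W.place (Affine.Point.some a _ hn)).toValuationSubring
  rw [mem_place_iff, not_le, placeValuation_some]
  simp only [Algebra.ofId_apply]
  -- valuations at `-T = (a, b')`
  set v := (pointPrime hn.left).valuation F with hv
  have hvreg : ∀ r : W.geomCoordRing, v (algebraMap W.geomCoordRing F r) ≤ 1 := fun r ↦
    HeightOneSpectrum.valuation_le_one _ _
  have hvlt : ∀ r : W.geomCoordRing, v (algebraMap W.geomCoordRing F r) < 1 ↔
      pointEval hn.left r = 0 := fun r ↦ by
    rw [hv, HeightOneSpectrum.valuation_lt_one_iff_mem, pointPrime_asIdeal,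
      mem_pointIdeal_iff hn.left]
  have hconst : ∀ c : AlgebraicClosure K, v (algebraMap (AlgebraicClosure K) F c) ≤ 1 := fun c ↦ by
    rw [IsScalarTower.algebraMap_apply (AlgebraicClosure K) W.geomCoordRing F]
    exact hvreg _
  -- `x - a` vanishes at `-T`
  have hxa : v (W.genX - algebraMap (AlgebraicClosure K) F a) < 1 := by
    have : W.genX - algebraMap (AlgebraicClosure K) F a = algebraMap W.geomCoordRing F
        (Affine.CoordinateRing.mk _ (C (X - C a))) := by
      rw [Literature.NumberTheory.EllipticCurves.WeierstrassFunctionField.algebraMap_mk, aevalAeval_C, map_sub, aeval_X, aeval_C]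
    rw [this, hvlt, pointEval_mk, evalEval_C, eval_sub, eval_X, eval_C, sub_self]
  -- `y - b` is a unit at `-T` (as `-T ≠ T`)
  have hyb : v (W.genY - algebraMap (AlgebraicClosure K) F b) = 1 := by
    have : W.genY - algebraMap (AlgebraicClosure K) F b = algebraMap W.geomCoordRing F
        (Affine.CoordinateRing.mk _ (Y - C (C b))) := by
      rw [Literature.NumberTheory.EllipticCurves.WeierstrassFunctionField.algebraMap_mk, map_sub, aevalAeval_Y, aevalAeval_C, aeval_C]
    rw [this]
    refine le_antisymm (hvreg _) (not_lt.mp fun hlt ↦ h2T ?_)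
    rw [hvlt, pointEval_mk, evalEval_sub, evalEval_X, evalEval_C, eval_C, sub_eq_zero] at hlt
    exact Affine.Point.add_self_of_Y_eq hlt.symm
  -- the slope has a pole at `-T`
  have hx0 : v (W.genX - algebraMap (AlgebraicClosure K) F a) ≠ 0 :=
    (Valuation.ne_zero_iff v).mpr (sub_ne_zero.mpr hxa')
  set ℓ := (W.baseChange F).toAffine.slope W.genX (algebraMap (AlgebraicClosure K) F a) W.genY
    (algebraMap (AlgebraicClosure K) F b) with hℓ
  have hℓ' : ℓ = (W.genY - algebraMap (AlgebraicClosure K) F b) /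
      (W.genX - algebraMap (AlgebraicClosure K) F a) := Affine.slope_of_X_ne hxa'
  have hvℓ : 1 < v ℓ := by
    rw [hℓ', map_div₀, hyb, one_lt_div₀ (zero_lt_iff.mpr hx0) ]
    exact hxa
  -- `τ_T^* x = ℓ² + (a₁ ℓ - a₂ - x - a)` and the bracket has valuation `≤ v ℓ < v ℓ²`
  have ha₁ : v ((W.baseChange F).toAffine.a₁ * ℓ) ≤ v ℓ := by
    rw [map_mul]
    refine mul_le_of_le_one_left' ?_
    change v (algebraMap K F W.a₁) ≤ 1
    rw [IsScalarTower.algebraMap_apply K (AlgebraicClosure K) F]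
    exact hconst _
  have ha₂ : v ((W.baseChange F).toAffine.a₂) ≤ v ℓ := by
    change v (algebraMap K F W.a₂) ≤ v ℓ
    rw [IsScalarTower.algebraMap_apply K (AlgebraicClosure K) F]
    exact (hconst _).trans hvℓ.le
  have hxv : v W.genX ≤ v ℓ := by
    have : W.genX = algebraMap W.geomCoordRing F (algebraMap (AlgebraicClosure K)[X] _ X) :=
      IsScalarTower.algebraMap_apply _ W.geomCoordRing F X
    rw [this]
    exact (hvreg _).trans hvℓ.le
  have hav : v (algebraMap (AlgebraicClosure K) F a) ≤ v ℓ := (hconst a).trans hvℓ.le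
  have hrest : v ((W.baseChange F).toAffine.a₁ * ℓ - (W.baseChange F).toAffine.a₂ - W.genX -
      algebraMap (AlgebraicClosure K) F a) ≤ v ℓ :=
    Valuation.map_sub_le _ (Valuation.map_sub_le _ (Valuation.map_sub_le _ ha₁ ha₂) hxv) hav
  have hℓ2 : v ℓ < v (ℓ ^ 2) := by
    rw [map_pow]
    exact lt_self_pow₀ hvℓ one_lt_two
  have hform : (W.baseChange F).toAffine.addX W.genX (algebraMap (AlgebraicClosure K) F a) ℓ =
      ℓ ^ 2 + ((W.baseChange F).toAffine.a₁ * ℓ - (W.baseChange F).toAffine.a₂ - W.genX -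
        algebraMap (AlgebraicClosure K) F a) := by
    rw [Affine.addX]; ring
  rw [hform, Valuation.map_add_eq_of_lt_left _ (hrest.trans_lt hℓ2)]
  exact hvℓ.trans hℓ2

/-- **`τ_T^* · O = T`** for `T ≠ O`, `2T ≠ O` (by elimination: `Q ↦ τ_T^* · Q` is injective, is
`Q + T` off `{O, -T}`, and maps `-T` to `O`). [folklore] -/
theorem pointComap_transAlgEquiv_zero {T : W.geomPoints} (hT : T ≠ 0) (h2T : T + T ≠ 0) :
    W.pointComap (W.transRingEquiv T) 0 = T := by
  have hinj := pointComap_transRingEquiv_injective (W := W) T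
  set R := W.pointComap (W.transRingEquiv T) 0 with hR
  have hR0 : R ≠ 0 := fun h ↦ by
    have h' : W.pointComap (W.transRingEquiv T) 0 = W.pointComap (W.transRingEquiv T) (-T) := by
      rw [← hR, h, pointComap_transAlgEquiv_neg hT h2T]
    exact hT (neg_eq_zero.mp (hinj h').symm)
  by_contra hRT
  have hQ0 : R - T ≠ 0 := sub_ne_zero.mpr hRT
  have hQT' : R - T + T ≠ 0 := by rwa [sub_add_cancel]
  by_cases hQT : R - T = T
  · have h1 : W.pointComap (W.transRingEquiv T) T = R := by
      rw [pointComap_transAlgEquiv_self hT h2T]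
      exact eq_sub_iff_add_eq.mp hQT.symm
    exact hT (hinj (h1.trans hR))
  · have h1 := pointComap_transAlgEquiv_of_ne hQ0 hQT hQT'
    rw [sub_add_cancel] at h1
    exact hQ0 (hinj (h1.trans hR))

/-- **`τ_T^* · O = T`** for a point `T` of order `2` (write `τ_T^* = τ_{T-S}^* ∘ τ_S^*` for a
point `S` avoiding `E[4] ∪ {T}`). [folklore] -/
theorem pointComap_transAlgEquiv_zero_of_two_torsion {T : W.geomPoints} (hT : T ≠ 0)
    (h2T : T + T = 0) : W.pointComap (W.transRingEquiv T) 0 = T := by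
  have hfin : ({S : W.geomPoints | (4 : ℤ) • S = 0} ∪ {T}).Finite :=
    ((finite_geomTorsion W (by norm_num : (4 : ℤ) ≠ 0)).subset fun S hS ↦
      (mem_torsionPoints_iff _ _ S).mpr hS).union (Set.toFinite _)
  obtain ⟨S, hS, hS0⟩ := geomPoints.exists_not_mem_of_finite hfin
  simp only [Set.mem_union, Set.mem_setOf_eq, Set.mem_singleton_iff, not_or] at hS
  obtain ⟨h4S, hST⟩ := hS
  have h4 : ∀ P : W.geomPoints, (4 : ℤ) • P = (P + P) + (P + P) := fun P ↦ by
    rw [show (4 : ℤ) = 2 + 2 by norm_num, add_zsmul, two_zsmul]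
  have h2S : S + S ≠ 0 := fun h ↦ h4S (by rw [h4, h, add_zero])
  have h2ST : S + S ≠ T := fun h ↦ h4S (by rw [h4, h, h2T])
  have hSA : S ≠ T - S := fun h ↦ h2ST (by rw [eq_sub_iff_add_eq] at h; exact h)
  have hSA' : S + (T - S) ≠ 0 := by rwa [add_sub_cancel]
  have hdec : W.transRingEquiv T = W.transRingEquiv (S + (T - S)) := by rw [add_sub_cancel]
  rw [hdec, pointComap_transAlgEquiv_add, pointComap_transAlgEquiv_zero hS0 h2S,
    pointComap_transAlgEquiv_of_ne hS0 hSA hSA', add_sub_cancel]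

/-- **`τ_T^* · T = O`** for a point `T` of order `2` (by elimination). [folklore] -/
theorem pointComap_transAlgEquiv_self_of_two_torsion {T : W.geomPoints} (hT : T ≠ 0)
    (h2T : T + T = 0) : W.pointComap (W.transRingEquiv T) T = 0 := by
  have hinj := pointComap_transRingEquiv_injective (W := W) T
  have h0 := pointComap_transAlgEquiv_zero_of_two_torsion hT h2T
  set R := W.pointComap (W.transRingEquiv T) T with hR
  by_contra hR0
  have hRT : R ≠ T := fun h ↦ hT (hinj (hR.symm.trans (h.trans h0.symm)))
  have hQ0 : R - T ≠ 0 := sub_ne_zero.mpr hRT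
  have hQT : R - T ≠ T := fun h ↦ hR0 (by
    rw [sub_eq_iff_eq_add] at h
    rw [h, h2T])
  have hQT' : R - T + T ≠ 0 := by rwa [sub_add_cancel]
  have h1 := pointComap_transAlgEquiv_of_ne hQ0 hQT hQT'
  rw [sub_add_cancel] at h1
  exact hQT (hinj (h1.trans hR))

/-- **Translations act on places as on points: `τ_T^* · Q = Q + T`** for all `T, Q ∈ E(K̄)`, i.e.
`{z : τ_T^* z ∈ K̄[E]_Q} = K̄[E]_{Q+T}`. Silverman, *AEC*, III.3.6 (`τ_T : E → E` is an isomorphism,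
`τ_T^*` the induced automorphism of `K̄(E)`), II.§2 (a morphism maps local rings to local rings).
[folklore] -/
theorem pointComap_transAlgEquiv (T Q : W.geomPoints) :
    W.pointComap (W.transRingEquiv T) Q = Q + T := by
  rcases eq_or_ne T 0 with rfl | hT
  · rw [add_zero, transRingEquiv_zero, pointComap_refl]
  by_cases h2T : T + T = 0
  · rcases eq_or_ne Q 0 with rfl | hQ
    · rw [zero_add]; exact pointComap_transAlgEquiv_zero_of_two_torsion hT h2T
    rcases eq_or_ne Q T with rfl | hQT
    · rw [h2T]; exact pointComap_transAlgEquiv_self_of_two_torsion hT h2T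
    have hQT' : Q + T ≠ 0 := fun h ↦ hQT (by rwa [← h2T, add_left_inj] at h)
    exact pointComap_transAlgEquiv_of_ne hQ hQT hQT'
  · rcases eq_or_ne Q 0 with rfl | hQ
    · rw [zero_add]; exact pointComap_transAlgEquiv_zero hT h2T
    rcases eq_or_ne Q T with rfl | hQT
    · exact pointComap_transAlgEquiv_self hT h2T
    by_cases hQT' : Q + T = 0
    · have hQe : Q = -T := eq_neg_of_add_eq_zero_left hQT'
      subst hQe
      rw [hQT']
      exact pointComap_transAlgEquiv_neg hT h2T
    · exact pointComap_transAlgEquiv_of_ne hQ hQT hQT'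

/-- **Transport of valuations under translations: `v_P (τ_T^* u) = v_{P+T} (u)`.**
Silverman, *AEC*, II.§2 and III.3.6 (`ord_P(τ_T^* f) = ord_{P+T}(f)`, `τ_T` being an unramified
isomorphism). [folklore] -/
theorem placeValuation_transAlgHom (T P : W.geomPoints) (u : W.geomFunctionField) :
    placeValuation (W.baseChange (AlgebraicClosure K)).toAffine P (W.transAlgHom T u) =
      placeValuation (W.baseChange (AlgebraicClosure K)).toAffine (P + T) u := by
  rw [← pointComap_transAlgEquiv T P, placeValuation_pointComap (preservesConstants_transRingEquiv T),
    transRingEquiv_apply]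

/-- **`ord_P (τ_T^* u) = ord_{P+T} (u)`.** Silverman, *AEC*, II.§2, III.3.6. [folklore] -/
theorem ord_transAlgHom (T P : W.geomPoints) (u : W.geomFunctionField) :
    ord (W.baseChange (AlgebraicClosure K)).toAffine P (W.transAlgHom T u) =
      ord (W.baseChange (AlgebraicClosure K)).toAffine (P + T) u := by
  simp only [ord, placeValuation_transAlgHom]

end Translation

/-! ## Principal divisors: `deg D = 0` and `sum D = O` imply `D = div (u)` -/

section Principal

variable [W.IsElliptic]

open FractionalIdeal

/-- `ord_P(u)` at an affine point is the multiplicity of `𝔪_P` in the fractional ideal `(u)`.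
[folklore] -/
theorem ord_some_eq_count {a b : AlgebraicClosure K}
    (h : (W.baseChange (AlgebraicClosure K)).toAffine.Nonsingular a b) {u : W.geomFunctionField}
    (hu : u ≠ 0) :
    ord (W.baseChange (AlgebraicClosure K)).toAffine (.some a b h) u =
      count W.geomFunctionField (pointPrime h.left)
        (spanSingleton W.geomCoordRing⁰ u) := by
  obtain ⟨n, d, hd, hnd⟩ := IsFractionRing.div_surjective (A := W.geomCoordRing) u
  have hd' : (d : W.geomCoordRing) ≠ 0 := nonZeroDivisors.ne_zero hd
  have hn : n ≠ 0 := by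
    rintro rfl
    rw [map_zero, zero_div] at hnd
    exact hu hnd.symm
  have hord : ∀ {w : W.geomCoordRing}, w ≠ 0 →
      ord (W.baseChange (AlgebraicClosure K)).toAffine (.some a b h)
        (algebraMap W.geomCoordRing W.geomFunctionField w) =
      ((Associates.mk (pointPrime h.left).asIdeal).count
        (Associates.mk (Ideal.span {w})).factors : ℤ) := fun hw ↦ by
    rw [ord, placeValuation_some, HeightOneSpectrum.valuation_of_algebraMap,
      HeightOneSpectrum.intValuation_if_neg _ hw, WithZero.log_exp, neg_neg]
  have hI : spanSingleton W.geomCoordRing⁰ u =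
      spanSingleton W.geomCoordRing⁰ ((algebraMap W.geomCoordRing W.geomFunctionField) d)⁻¹ *
        ↑(Ideal.span {n} : Ideal W.geomCoordRing) := by
    rw [coeIdeal_span_singleton, spanSingleton_mul_spanSingleton, ← hnd, div_eq_inv_mul]
  rw [count_well_defined W.geomFunctionField (pointPrime h.left)
      ((spanSingleton_eq_zero_iff).not.mpr hu) hI, ← hnd,
    ord_div _ (by simpa using hn) (by simpa using hd'), hord hn, hord hd']

variable (W) in
/-- The invertible fractional ideal `𝔪_P` of an affine point (Mathlib's `XYIdeal'`), and `1` at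
`O`: the ideal-theoretic shadow of the divisor `(P)` (up to multiples of `(O)`). [folklore] -/
def pointFracIdeal : W.geomPoints →
    (FractionalIdeal W.geomCoordRing⁰ W.geomFunctionField)ˣ :=
  fun P ↦ match (P : (W.baseChange (AlgebraicClosure K)).toAffine.Point) with
    | .zero => 1
    | .some _ _ h => Affine.CoordinateRing.XYIdeal' h

/-- `pointFracIdeal O = 1`. [folklore] -/
@[simp] theorem pointFracIdeal_zero : W.pointFracIdeal 0 = 1 := rfl

/-- `pointFracIdeal (a, b) = 𝔪_{(a,b)}` as a fractional ideal. [folklore] -/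
theorem coe_pointFracIdeal_some {a b : AlgebraicClosure K}
    (h : (W.baseChange (AlgebraicClosure K)).toAffine.Nonsingular a b) :
    ((W.pointFracIdeal (.some a b h) : (FractionalIdeal W.geomCoordRing⁰ W.geomFunctionField)ˣ) :
      FractionalIdeal W.geomCoordRing⁰ W.geomFunctionField) =
        ((pointPrime h.left).asIdeal : FractionalIdeal W.geomCoordRing⁰ W.geomFunctionField) :=
  rfl

/-- **The class of `𝔪_P` is the class of `P`** under Mathlib's `toClass : E(K̄) → Cl(K̄[E])`.
[folklore] -/
theorem mk_pointFracIdeal (P : W.geomPoints) :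
    ClassGroup.mk W.geomFunctionField (W.pointFracIdeal P) =
      Additive.toMul (Affine.Point.toClass (P : (W.baseChange (AlgebraicClosure K)).toAffine.Point)) := by
  cases P with
  | zero =>
    change ClassGroup.mk W.geomFunctionField 1 =
      Additive.toMul (Affine.Point.toClass (0 : (W.baseChange (AlgebraicClosure K)).toAffine.Point))
    rw [map_one, Affine.Point.toClass_zero, toMul_zero]
  | some a b h => rfl

/-- The multiplicity of `𝔪_P` in `pointFracIdeal P` is `1` (`P` affine). [folklore] -/
theorem count_pointFracIdeal_self {a b : AlgebraicClosure K}
    (h : (W.baseChange (AlgebraicClosure K)).toAffine.Nonsingular a b) :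
    count W.geomFunctionField (pointPrime h.left)
      ((W.pointFracIdeal (.some a b h) :
        (FractionalIdeal W.geomCoordRing⁰ W.geomFunctionField)ˣ) :
          FractionalIdeal W.geomCoordRing⁰ W.geomFunctionField) = 1 :=
  count_self W.geomFunctionField _

/-- The multiplicity of `𝔪_P` (`P` affine) in `pointFracIdeal Q` is `0` for `Q ≠ P`. [folklore] -/
theorem count_pointFracIdeal_of_ne {a b : AlgebraicClosure K}
    (h : (W.baseChange (AlgebraicClosure K)).toAffine.Nonsingular a b) {Q : W.geomPoints}
    (hQ : Q ≠ .some a b h) :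
    count W.geomFunctionField (pointPrime h.left)
      ((W.pointFracIdeal Q : (FractionalIdeal W.geomCoordRing⁰ W.geomFunctionField)ˣ) :
        FractionalIdeal W.geomCoordRing⁰ W.geomFunctionField) = 0 := by
  cases Q with
  | zero =>
    change count W.geomFunctionField (pointPrime h.left)
      ((1 : (FractionalIdeal W.geomCoordRing⁰ W.geomFunctionField)ˣ) :
        FractionalIdeal W.geomCoordRing⁰ W.geomFunctionField) = _
    rw [Units.val_one, count_one]
  | some a' b' h' =>
    change count W.geomFunctionField (pointPrime h.left)
      ((pointPrime h'.left).asIdeal : FractionalIdeal W.geomCoordRing⁰ W.geomFunctionField) = _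
    refine count_maximal_coprime W.geomFunctionField _ fun hP ↦ hQ ?_
    obtain ⟨rfl, rfl⟩ := pointIdeal_injective h'.left (congrArg HeightOneSpectrum.asIdeal hP)
    rfl

/-- Multiplicities of powers of units of fractional ideals. [folklore] -/
theorem count_units_zpow (v : HeightOneSpectrum W.geomCoordRing)
    (x : (FractionalIdeal W.geomCoordRing⁰ W.geomFunctionField)ˣ) (n : ℤ) :
    count W.geomFunctionField v ((x ^ n : (FractionalIdeal W.geomCoordRing⁰ W.geomFunctionField)ˣ) :
      FractionalIdeal W.geomCoordRing⁰ W.geomFunctionField) =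
      n * count W.geomFunctionField v (x : FractionalIdeal W.geomCoordRing⁰ W.geomFunctionField) := by
  rw [Units.val_zpow_eq_zpow_val (α := FractionalIdeal W.geomCoordRing⁰ W.geomFunctionField),
    count_zpow]

/-- **Abel–Jacobi criterion for principal divisors on `E`** (Silverman, *AEC*, Cor. III.3.5:
"`D = Σ n_P (P)` is principal if and only if `Σ n_P = 0` and `Σ [n_P] P = O`", the direction ⇐):
for a finitely supported `D : E(K̄) → ℤ` of degree `0` whose points sum to `O` in the group `E(K̄)`
there is `u ∈ K̄(E)^×` with `ord_P(u) = D(P)` for every `P` (including `O`). Proof: the fractional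
ideal `∏_{P ≠ O} 𝔪_P^{D(P)}` of `K̄[E]` has trivial class, the class of `𝔪_P` being the class of
`P` under Mathlib's injective homomorphism `toClass : E(K̄) → Cl(K̄[E])`; a generator `u` has the
prescribed orders at the affine points, and at `O` by `deg (div u) = 0` (`finsum_ord`).
[cite: SilvermanAEC2009, Cor. III.3.5] -/
theorem exists_ord_eq (D : W.geomPoints →₀ ℤ) (hdeg : D.sum (fun _ n ↦ n) = 0)
    (hsum : D.sum (fun P n ↦ n • P) = 0) :
    ∃ u : W.geomFunctionField, u ≠ 0 ∧
      ∀ P : W.geomPoints, ord (W.baseChange (AlgebraicClosure K)).toAffine P u = D P := by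
  set I : (FractionalIdeal W.geomCoordRing⁰ W.geomFunctionField)ˣ :=
    D.prod fun P n ↦ W.pointFracIdeal P ^ n with hI
  -- the class of `I` is `toClass (Σ D(P) • P) = 1`
  have hprod : ∀ s : Finset W.geomPoints,
      ClassGroup.mk W.geomFunctionField (∏ P ∈ s, W.pointFracIdeal P ^ (D P)) =
        Additive.toMul (Affine.Point.toClass
          ((∑ P ∈ s, D P • P : W.geomPoints) : (W.baseChange (AlgebraicClosure K)).toAffine.Point)) := by
    intro s
    induction s using Finset.induction_on with
    | empty =>
      rw [Finset.prod_empty, Finset.sum_empty, map_one]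
      exact (toMul_zero).symm.trans (congrArg Additive.toMul
        (Affine.Point.toClass_zero (W := (W.baseChange (AlgebraicClosure K)).toAffine)).symm)
    | insert a s ha ih =>
      rw [Finset.prod_insert ha, Finset.sum_insert ha, map_mul, map_zpow, ih, mk_pointFracIdeal,
        ← toMul_zsmul, ← toMul_add, ← map_zsmul, ← map_add]
      rfl
  have hmk : ClassGroup.mk W.geomFunctionField I = 1 := by
    rw [hI, Finsupp.prod, hprod]
    have : (∑ P ∈ D.support, D P • P : W.geomPoints) = 0 := hsum
    rw [this]
    exact (congrArg Additive.toMul (Affine.Point.toClass_zero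
      (W := (W.baseChange (AlgebraicClosure K)).toAffine))).trans toMul_zero
  obtain ⟨u, hIu⟩ := (isPrincipal_iff _).mp (ClassGroup.mk_eq_one_iff.mp hmk)
  have hu : u ≠ 0 := fun h0 ↦ I.ne_zero (by rw [hIu, h0, spanSingleton_zero])
  -- orders at affine points
  have haff : ∀ {a b : AlgebraicClosure K}
      (h : (W.baseChange (AlgebraicClosure K)).toAffine.Nonsingular a b),
      ord (W.baseChange (AlgebraicClosure K)).toAffine (.some a b h) u = D (.some a b h) := by
    intro a b h
    rw [ord_some_eq_count h hu, ← hIu, hI, Finsupp.prod, Units.coe_prod,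
      count_prod W.geomFunctionField (pointPrime h.left) D.support _ (fun P _ ↦ Units.ne_zero _)]
    simp_rw [count_units_zpow]
    rw [Finset.sum_eq_single (s := D.support) (Affine.Point.some a b h)]
    · rw [count_pointFracIdeal_self, mul_one]
    · intro Q _ hQ
      rw [count_pointFracIdeal_of_ne h hQ, mul_zero]
    · intro hP
      rw [Finsupp.notMem_support_iff.mp hP, zero_mul]
  have haff' : ∀ P : W.geomPoints, P ≠ 0 →
      ord (W.baseChange (AlgebraicClosure K)).toAffine P u = D P := by
    intro P hP
    obtain ⟨a, b, h, rfl⟩ := geomPoints.exists_eq_some hP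
    exact haff h
  refine ⟨u, hu, fun P ↦ ?_⟩
  rcases eq_or_ne P 0 with rfl | hP
  · -- the order at `O` from `deg (div u) = 0`
    have h0 : ∑ᶠ P : W.geomPoints, ord (W.baseChange (AlgebraicClosure K)).toAffine P u = 0 :=
      finsum_ord (V := (W.baseChange (AlgebraicClosure K)).toAffine) hu
    have hsupp : (Function.support fun P : W.geomPoints ↦
        ord (W.baseChange (AlgebraicClosure K)).toAffine P u) ⊆
          ((insert 0 D.support : Finset W.geomPoints) : Set W.geomPoints) := by
      intro P hP
      rw [Finset.coe_insert, Set.mem_insert_iff]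
      rcases eq_or_ne P 0 with rfl | hP0
      · exact Or.inl rfl
      · right
        rw [Function.mem_support, haff' P hP0] at hP
        exact Finsupp.mem_support_iff.mpr hP
    rw [finsum_eq_sum_of_support_subset _ hsupp] at h0
    have hdeg' : ∑ P ∈ D.support, D P = 0 := hdeg
    by_cases hmem : (0 : W.geomPoints) ∈ D.support
    · rw [Finset.insert_eq_of_mem hmem, ← Finset.add_sum_erase _ _ hmem] at h0
      rw [← Finset.add_sum_erase _ _ hmem] at hdeg'
      have : ∑ P ∈ D.support.erase 0, ord (W.baseChange (AlgebraicClosure K)).toAffine P u =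
          ∑ P ∈ D.support.erase 0, D P :=
        Finset.sum_congr rfl fun P hP ↦ haff' P (Finset.ne_of_mem_erase hP)
      omega
    · rw [Finset.sum_insert hmem] at h0
      have : ∑ P ∈ D.support, ord (W.baseChange (AlgebraicClosure K)).toAffine P u =
          ∑ P ∈ D.support, D P :=
        Finset.sum_congr rfl fun P hP ↦ haff' P (fun e ↦ hmem (e ▸ hP))
      rw [Finsupp.notMem_support_iff.mp hmem]
      omega
  · exact haff' P hP

/-- **Principal divisors of the form `Σ_i (P_i) - (Q_i)`**: if `Σ_i (P_i - Q_i) = O` in `E(K̄)`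
then there is `u ∈ K̄(E)^×` with `ord_P (u) = #{i : P = P_i} - #{i : P = Q_i}` for all `P`
(`exists_ord_eq` for the divisor `Σ_i (P_i) - (Q_i)`, automatically of degree `0`).
[cite: SilvermanAEC2009, Cor. III.3.5] -/
theorem exists_ord_eq_of_pairs {ι : Type*} (s : Finset ι) (pt pt' : ι → W.geomPoints)
    (hsum : ∑ i ∈ s, (pt i - pt' i) = 0) :
    ∃ u : W.geomFunctionField, u ≠ 0 ∧
      ∀ P : W.geomPoints, ord (W.baseChange (AlgebraicClosure K)).toAffine P u =
        ∑ i ∈ s, ((if P = pt i then (1 : ℤ) else 0) - (if P = pt' i then (1 : ℤ) else 0)) := by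
  set D : W.geomPoints →₀ ℤ :=
    ∑ i ∈ s, Finsupp.single (pt i) 1 - ∑ i ∈ s, Finsupp.single (pt' i) 1 with hD
  have h1 : (∑ i ∈ s, Finsupp.single (pt i) (1 : ℤ)).sum (fun _ n ↦ n) = ∑ i ∈ s, (1 : ℤ) := by
    rw [← Finsupp.sum_finsetSum_index (h := fun (_ : W.geomPoints) (n : ℤ) ↦ n) (fun _ ↦ rfl) (fun _ _ _ ↦ rfl)]
    exact Finset.sum_congr rfl fun i _ ↦ Finsupp.sum_single_index rfl
  have h2 : (∑ i ∈ s, Finsupp.single (pt' i) (1 : ℤ)).sum (fun _ n ↦ n) = ∑ i ∈ s, (1 : ℤ) := by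
    rw [← Finsupp.sum_finsetSum_index (h := fun (_ : W.geomPoints) (n : ℤ) ↦ n) (fun _ ↦ rfl) (fun _ _ _ ↦ rfl)]
    exact Finset.sum_congr rfl fun i _ ↦ Finsupp.sum_single_index rfl
  have h3 : (∑ i ∈ s, Finsupp.single (pt i) (1 : ℤ)).sum (fun P n ↦ n • P) = ∑ i ∈ s, pt i := by
    rw [← Finsupp.sum_finsetSum_index (h := fun (P : W.geomPoints) (n : ℤ) ↦ n • P) (fun _ ↦ zero_zsmul _) (fun _ _ _ ↦ add_zsmul _ _ _)]
    exact Finset.sum_congr rfl fun i _ ↦ by rw [Finsupp.sum_single_index (zero_zsmul _), one_zsmul]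
  have h4 : (∑ i ∈ s, Finsupp.single (pt' i) (1 : ℤ)).sum (fun P n ↦ n • P) = ∑ i ∈ s, pt' i := by
    rw [← Finsupp.sum_finsetSum_index (h := fun (P : W.geomPoints) (n : ℤ) ↦ n • P) (fun _ ↦ zero_zsmul _) (fun _ _ _ ↦ add_zsmul _ _ _)]
    exact Finset.sum_congr rfl fun i _ ↦ by rw [Finsupp.sum_single_index (zero_zsmul _), one_zsmul]
  have hdeg : D.sum (fun _ n ↦ n) = 0 := by
    rw [hD, Finsupp.sum_sub_index (fun _ _ _ ↦ rfl), h1, h2, sub_self]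
  have hsum' : D.sum (fun P n ↦ n • P) = 0 := by
    rw [hD, Finsupp.sum_sub_index (fun _ _ _ ↦ sub_zsmul _ _ _), h3, h4, ← Finset.sum_sub_distrib,
      hsum]
  obtain ⟨u, hu, hord⟩ := exists_ord_eq D hdeg hsum'
  refine ⟨u, hu, fun P ↦ ?_⟩
  rw [hord P, hD, Finsupp.sub_apply, Finsupp.finsetSum_apply, Finsupp.finsetSum_apply,
    ← Finset.sum_sub_distrib]
  refine Finset.sum_congr rfl fun i _ ↦ ?_
  by_cases e1 : P = pt i <;> by_cases e2 : P = pt' i <;>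
    simp [Finsupp.single_apply, e1, e2, eq_comm]

/-- **A function with `ord_P(u) ≥ 0` everywhere is constant** (Silverman, *AEC*, Prop. II.1.2;
the tree's `exists_eq_algebraMap_of_forall_mem`, every place of `K̄(E)` being the place of a
point). [cite: SilvermanAEC2009, Prop. II.1.2] -/
theorem exists_eq_algebraMap_of_ord_nonneg {u : W.geomFunctionField}
    (h : ∀ P : W.geomPoints, 0 ≤ ord (W.baseChange (AlgebraicClosure K)).toAffine P u) :
    ∃ c : AlgebraicClosure K, algebraMap (AlgebraicClosure K) W.geomFunctionField c = u := by
  rcases eq_or_ne u 0 with rfl | hu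
  · exact ⟨0, map_zero _⟩
  refine Literature.NumberTheory.DiophantineGeometry.WeierstrassPlaces.exists_eq_algebraMap_of_forall_mem _ fun 𝔓 ↦ ?_
  obtain ⟨P, rfl⟩ := place_surjective 𝔓
  rw [mem_place_iff, placeValuation_eq_exp_neg_ord P hu, ← WithZero.exp_zero, WithZero.exp_le_exp,
    neg_nonpos]
  exact h P

/-- **Functions with the same divisor differ by a non-zero constant.** [folklore] -/
theorem exists_eq_smul_of_ord_eq {u w : W.geomFunctionField} (hu : u ≠ 0) (hw : w ≠ 0)
    (h : ∀ P : W.geomPoints, ord (W.baseChange (AlgebraicClosure K)).toAffine P u =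
      ord (W.baseChange (AlgebraicClosure K)).toAffine P w) :
    ∃ c : AlgebraicClosure K, c ≠ 0 ∧ w = algebraMap (AlgebraicClosure K) W.geomFunctionField c * u := by
  obtain ⟨c, hc⟩ := exists_eq_algebraMap_of_ord_nonneg (W := W) (u := w / u) fun P ↦ by
    rw [ord_div P hw hu, h P, sub_self]
  refine ⟨c, fun h0 ↦ ?_, ?_⟩
  · rw [h0, map_zero, eq_comm, div_eq_zero_iff] at hc
    exact hc.elim hw hu
  · rw [hc, div_mul_cancel₀ _ hu]

/-- **`(T) - (O)` is not principal for `T ≠ O`** (Silverman, *AEC*, Prop. III.3.3 / Cor. III.3.5 ⇒: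
a function with a single simple zero at `T`, a single simple pole at `O` and no other zeros or
poles would make the class of `𝔪_T` trivial, contradicting the injectivity of `toClass`; equivalently
`E ≇ ℙ¹`). [cite: SilvermanAEC2009, Cor. III.3.5] -/
theorem eq_zero_of_ord_eq_single {u : W.geomFunctionField} (hu : u ≠ 0) {T : W.geomPoints}
    (h : ∀ P : W.geomPoints, P ≠ 0 → ord (W.baseChange (AlgebraicClosure K)).toAffine P u =
      if P = T then 1 else 0) : T = 0 := by
  by_contra hT
  obtain ⟨a, b, hab, rfl⟩ := geomPoints.exists_eq_some hT
  -- `(u) = 𝔪_T` as fractional ideals: same multiplicity at every height-one prime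
  have hcount : ∀ v : HeightOneSpectrum W.geomCoordRing, count W.geomFunctionField v (spanSingleton W.geomCoordRing⁰ u) =
      count W.geomFunctionField v ((W.pointFracIdeal (.some a b hab) : (FractionalIdeal W.geomCoordRing⁰ W.geomFunctionField)ˣ) :
        FractionalIdeal W.geomCoordRing⁰ W.geomFunctionField) := by
    intro v
    obtain ⟨a', b', h', rfl⟩ := exists_maxIdealAt_eq (W := W) v
    rw [maxIdealAt_eq_pointPrime, ← ord_some_eq_count h' hu, h _ (Affine.Point.some_ne_zero _)]
    split_ifs with e
    · obtain ⟨rfl, rfl⟩ := Affine.Point.some.inj e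
      exact (count_pointFracIdeal_self h').symm
    · exact (count_pointFracIdeal_of_ne h' (Ne.symm e)).symm
  have heq : spanSingleton W.geomCoordRing⁰ u = ((W.pointFracIdeal (.some a b hab) :
      (FractionalIdeal W.geomCoordRing⁰ W.geomFunctionField)ˣ) : FractionalIdeal W.geomCoordRing⁰ W.geomFunctionField) := by
    rw [← finprod_heightOneSpectrum_factorization' W.geomFunctionField
        (I := spanSingleton W.geomCoordRing⁰ u) ((spanSingleton_eq_zero_iff).not.mpr hu),
      ← finprod_heightOneSpectrum_factorization' W.geomFunctionField
        (I := ((W.pointFracIdeal (.some a b hab) :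
          (FractionalIdeal W.geomCoordRing⁰ W.geomFunctionField)ˣ) :
            FractionalIdeal W.geomCoordRing⁰ W.geomFunctionField)) (Units.ne_zero _)]
    exact finprod_congr fun v ↦ by rw [hcount v]
  -- hence the class of `T` is trivial
  have hmk : ClassGroup.mk W.geomFunctionField (W.pointFracIdeal (.some a b hab)) = 1 := by
    rw [ClassGroup.mk_eq_one_iff]
    have : ((W.pointFracIdeal (.some a b hab) : (FractionalIdeal W.geomCoordRing⁰ W.geomFunctionField)ˣ) : Submodule W.geomCoordRing W.geomFunctionField) =
        (spanSingleton W.geomCoordRing⁰ u : Submodule W.geomCoordRing W.geomFunctionField) := by rw [heq]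
    rw [this, coe_spanSingleton]
    exact ⟨u, rfl⟩
  rw [mk_pointFracIdeal] at hmk
  have h0 := (Affine.Point.toClass_eq_zero _).mp (show Affine.Point.toClass
    (Affine.Point.some a b hab : (W.baseChange (AlgebraicClosure K)).toAffine.Point) = 0 from hmk)
  exact Affine.Point.some_ne_zero _ h0

end Principal

/-! ## Norms along a finite set of translations -/

section Norm

variable [W.IsElliptic]

/-- **The divisor of a product of translates**: `ord_P (∏_{R ∈ s} τ_R^* w) = Σ_{R ∈ s} ord_{P+R} (w)`.
[folklore] -/
theorem ord_prod_transAlgHom (s : Finset W.geomPoints) {w : W.geomFunctionField} (hw : w ≠ 0)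
    (P : W.geomPoints) :
    ord (W.baseChange (AlgebraicClosure K)).toAffine P (∏ R ∈ s, W.transAlgHom R w) =
      ∑ R ∈ s, ord (W.baseChange (AlgebraicClosure K)).toAffine (P + R) w := by
  induction s using Finset.induction_on with
  | empty => simp [ord]
  | insert R s hR ih =>
    rw [Finset.prod_insert hR, Finset.sum_insert hR, ord_mul P, ih, ord_transAlgHom]
    · exact (map_ne_zero_iff _ (W.transAlgHom R).injective).mpr hw
    · exact Finset.prod_ne_zero_iff.mpr fun R' _ ↦
        (map_ne_zero_iff _ (W.transAlgHom R').injective).mpr hw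

/-- A product of translates of a non-zero function is non-zero. [folklore] -/
theorem prod_transAlgHom_ne_zero (s : Finset W.geomPoints) {w : W.geomFunctionField} (hw : w ≠ 0) :
    ∏ R ∈ s, W.transAlgHom R w ≠ 0 :=
  Finset.prod_ne_zero_iff.mpr fun R _ ↦ (map_ne_zero_iff _ (W.transAlgHom R).injective).mpr hw

end Norm

/-! ## Pull-back of places along an isogeny: `v_P ∘ φ^* = v_{φ P}^e` -/

namespace Isogeny

variable {W' : WeierstrassCurve K} [W.IsElliptic] [W'.IsElliptic] (φ : Isogeny W W')

omit [W'.IsElliptic] in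
/-- Values of pulled-back regular functions at a point of agreement of *any* rational
representation `r` of `φ` (the tree's `hasValueAt_pullbackHom_algebraMap` is the case
`r = φ.rationalRep`): `(φ^* r')(P) = r'(φ P)` for `r' ∈ K̄[E']`. Silverman, *AEC*, II.§2.
[folklore] -/
theorem hasValueAt_pullbackHom_algebraMap_of_rationalRep (r : RationalRep W W' φ)
    {P : W.geomPoints} (hP : AgreesWithRationalMapAt W W' r.P₁ r.Q₁ r.P₂ r.Q₂ φ P)
    {a b : AlgebraicClosure K} (h : (W'.baseChange (AlgebraicClosure K)).toAffine.Nonsingular a b)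
    (hφP : φ P = .some a b h) (r' : W'.geomCoordRing) :
    W.HasValueAt (φ.pullbackHom (algebraMap W'.geomCoordRing W'.geomFunctionField r')) P
      (evalAt h r') := by
  have hvx : W.HasValueAt φ.pullbackX P a := by
    have := r.hasValueAt_pullbackX hP
    rw [hφP, xy_some, Matrix.cons_val_zero] at this
    rwa [φ.pullbackX_eq r]
  have hvy : W.HasValueAt φ.pullbackY P b := by
    have := r.hasValueAt_pullbackY hP
    rw [hφP, xy_some, Matrix.cons_val_one, Matrix.cons_val_zero] at this
    rwa [φ.pullbackY_eq r]
  have hw : ∀ i, W.HasValueAt (![φ.pullbackX, φ.pullbackY] i) P (![a, b] i) := by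
    intro i; fin_cases i
    · exact hvx
    · exact hvy
  obtain ⟨p, rfl⟩ := AdjoinRoot.mk_surjective r'
  change W.HasValueAt (φ.pullbackHom (algebraMap W'.geomCoordRing W'.geomFunctionField
    (Affine.CoordinateRing.mk _ p))) P (evalAt h (Affine.CoordinateRing.mk _ p))
  set eqv := Polynomial.Bivariate.equivMvPolynomial (AlgebraicClosure K)
  rw [pullbackHom_algebraMap, pointAlgHom_mk, ← aevalAeval_eq_evalEval_map,
    ← eqv.symm_apply_apply p, aevalAeval_equivMvPolynomial_symm, evalAt_mk_equivMvPolynomial_symm]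
  exact HasValueAt.aeval hw _

/-- **The place at a point of agreement `P` lies above the place at `φ P`**, for any rational
representation of `φ` (cf. the tree's `comap_pullbackHom_place` for `φ.rationalRep`):
`K̄[E]_P ∩ φ^* K̄(E') = φ^* K̄[E']_{φ P}`. Silverman, *AEC*, II.§2. [folklore] -/
theorem comap_pullbackHom_place_of_rationalRep (r : RationalRep W W' φ) {P : W.geomPoints}
    (hP : AgreesWithRationalMapAt W W' r.P₁ r.Q₁ r.P₂ r.Q₂ φ P) :
    (W.place P).toValuationSubring.comap
        (φ.pullbackHom : W'.geomFunctionField →+* W.geomFunctionField) =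
      (W'.place (φ P)).toValuationSubring := by
  refine (ValuationSubring.eq_of_le_of_ne_top _ ?_
    (φ.comap_pullbackHom_ne_top (W.place P).ne_top)).symm
  obtain ⟨hP0, hQ₁, hQ₂, h', e⟩ := agreesWithRationalMapAt_iff.mp hP
  intro z' hz'
  rw [ValuationSubring.mem_comap]
  rw [e] at hz'
  obtain ⟨c, hc⟩ := exists_hasValueAt_of_mem_place (Affine.Point.some_ne_zero _) hz'
  -- write `z' = n/d` with `d(φ P) ≠ 0`
  rw [place_some, PlaceOver.mem_ofPrime_iff] at hz'
  obtain ⟨n, d, hnd⟩ := (maxIdealAt h').exists_primeCompl_mul_eq_of_integer z' hz'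
  have hd : evalAt h' (d : W'.geomCoordRing) ≠ 0 := fun h0 ↦
    d.2 ((mem_maxIdealAt_iff h' _).mpr h0)
  have hvn := φ.hasValueAt_pullbackHom_algebraMap_of_rationalRep r hP h' e n
  have hvd := φ.hasValueAt_pullbackHom_algebraMap_of_rationalRep r hP h' e d
  have hd0 : φ.pullbackHom (algebraMap W'.geomCoordRing W'.geomFunctionField d) ≠ 0 :=
    hvd.ne_zero hP0 hd
  have hz'' : (φ.pullbackHom : W'.geomFunctionField →+* W.geomFunctionField) z' =
      φ.pullbackHom (algebraMap W'.geomCoordRing W'.geomFunctionField n) /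
        φ.pullbackHom (algebraMap W'.geomCoordRing W'.geomFunctionField d) := by
    rw [eq_div_iff hd0, AlgHom.coe_toRingHom, ← map_mul, hnd]
  rw [hz'']
  exact ((hvn.div hP0 hvd hd).mem_place hP0).1

/-- **`v_P ∘ φ^* = v_{φP}^{e}` with `e = e_φ(P) ≥ 1`** at a point of agreement `P` of a rational
representation of `φ`: `v_P(φ^* z) = v_{φ P}(z)^{e}` for all `z ∈ K̄(E')`, where `e` is the
ramification index of `φ` at `P`. Silverman, *AEC*, II.§2 (definition of `e_φ(P)`; Ex. 2.2:
`ord_P(φ^* f) = e_φ(P) ord_{φP}(f)`). [cite: SilvermanAEC2009, II.§2 (e_φ(P))] -/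
theorem exists_placeValuation_pullbackHom_eq_pow (r : RationalRep W W' φ) {P : W.geomPoints}
    (hP : AgreesWithRationalMapAt W W' r.P₁ r.Q₁ r.P₂ r.Q₂ φ P) :
    ∃ e : ℕ, 1 ≤ e ∧ ∀ z : W'.geomFunctionField,
      placeValuation (W.baseChange (AlgebraicClosure K)).toAffine P (φ.pullbackHom z) =
        placeValuation (W'.baseChange (AlgebraicClosure K)).toAffine (φ P) z ^ e := by
  set v' := (placeValuation (W.baseChange (AlgebraicClosure K)).toAffine P).comap
    (φ.pullbackHom : W'.geomFunctionField →+* W.geomFunctionField) with hv'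
  have hsub : v'.valuationSubring =
      (placeValuation (W'.baseChange (AlgebraicClosure K)).toAffine (φ P)).valuationSubring := by
    rw [← place_toValuationSubring, ← φ.comap_pullbackHom_place_of_rationalRep r hP]
    ext z
    rw [Valuation.mem_valuationSubring_iff, ValuationSubring.mem_comap, mem_place_iff]
    rfl
  have hequiv := (Valuation.isEquiv_iff_valuationSubring _ _).mpr hsub
  obtain ⟨π, hπ⟩ := exists_placeValuation_eq_exp_neg_one (W := W') (φ P)
  obtain ⟨e, he, hve⟩ := Literature.NumberTheory.EllipticCurves.WeilPairingDivisors.exists_eq_pow_of_isEquiv hequiv hπ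
  exact ⟨e, he, fun z ↦ by rw [← hve z]; rfl⟩

end Isogeny

section Zsmul

variable [W.IsElliptic]

/-- **Pull-back of orders along `[m]`**: for `P` with `m • P ≠ O` there is `e ≥ 1` (the
ramification index of `[m]` at `P`; in fact `e = 1`, which is not needed here) with
`ord_P ([m]^* u) = e · ord_{mP} (u)` for all `u ∈ K̄(E)^×`. Silverman, *AEC*, II.§2, III.§4.
[cite: SilvermanAEC2009, II.§2 (e_φ(P)), Exercise 3.7(d)] -/
theorem exists_ord_pullbackHom_zsmul {m : ℤ} (hm : m ≠ 0) {P : W.geomPoints} (hP : m • P ≠ 0) :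
    ∃ e : ℕ, 1 ≤ e ∧ ∀ u : W.geomFunctionField, u ≠ 0 →
      ord (W.baseChange (AlgebraicClosure K)).toAffine P ((Isogeny.zsmul W m hm).pullbackHom u) =
        e * ord (W.baseChange (AlgebraicClosure K)).toAffine (m • P) u := by
  obtain ⟨e, he, hve⟩ := (Isogeny.zsmul W m hm).exists_placeValuation_pullbackHom_eq_pow
    (W.zsmulRationalRep m hm) (agreesWithRationalMapAt_zsmul W hP)
  refine ⟨e, he, fun u hu ↦ ?_⟩
  have hu' : (Isogeny.zsmul W m hm).pullbackHom u ≠ 0 :=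
    (map_ne_zero_iff _ (Isogeny.zsmul W m hm).pullbackHom.injective).mpr hu
  have h := hve u
  rw [placeValuation_eq_exp_neg_ord _ hu', placeValuation_eq_exp_neg_ord _ hu, ← WithZero.exp_nsmul,
    WithZero.exp_inj, nsmul_eq_mul, Isogeny.zsmul_apply] at h
  linarith

end Zsmul

end WeierstrassCurve

/-! ## Part 2 (appended). `[m](x, y)` on the generic point and `τ_S^* ∘ [m]^* = [m]^* ∘ τ_{mS}^*` -/

namespace WeierstrassCurve

open _root_.WeierstrassCurve.geomPoints Literature.NumberTheory.EllipticCurves.WeierstrassFunctionField Literature.NumberTheory.DiophantineGeometry.AlgFunctionField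
open Literature.NumberTheory.EllipticCurves

variable {K : Type u} [Field K] {W : WeierstrassCurve K}

section GenericImage

/-- Evaluating `univSpec u` (`IsogenyMulProofs`) at the generic point is the specialisation
`ev E_{K̄(E)} x y u` of the universal pointed curve (`DivisionPolynomialMultiplication`).
[folklore] -/
theorem evalGeneric_univSpec (u : UnivEC.U) :
    W.evalGeneric (W.univSpec u) = UnivEC.ev (W.baseChange W.geomFunctionField) W.genX W.genY u := by
  have key : (MvPolynomial.aeval ![W.genX, W.genY]).toRingHom.comp W.univSpec =
      UnivEC.ev (W.baseChange W.geomFunctionField) W.genX W.genY := by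
    refine MvPolynomial.ringHom_ext (fun r ↦ by simp [univSpec, UnivEC.ev]) fun i ↦ ?_
    fin_cases i <;>
      simp [univSpec, UnivEC.ev, WeierstrassCurve.baseChange,
        ← IsScalarTower.algebraMap_apply K (AlgebraicClosure K) W.geomFunctionField]
  rw [evalGeneric_eq_aeval]
  exact RingHom.congr_fun key u

/-- `ψₙ(x, y) ∈ K̄(E)` as the division polynomial of `E / K̄(E)` at the generic point. [folklore] -/
theorem evalGeneric_univSpec_ψ (n : ℤ) :
    W.evalGeneric (W.univSpec (UnivEC.ψ n)) =
      ((W.baseChange W.geomFunctionField).ψ n).evalEval W.genX W.genY := by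
  rw [evalGeneric_univSpec, UnivEC.map_ψ, UnivEC.curve_map_ev (equation_genX_genY W),
    UnivEC.ev_xU, UnivEC.ev_yU]

/-- `φₙ(x, y) ∈ K̄(E)` as the division polynomial of `E / K̄(E)` at the generic point. [folklore] -/
theorem evalGeneric_univSpec_φ (n : ℤ) :
    W.evalGeneric (W.univSpec (UnivEC.φ n)) =
      ((W.baseChange W.geomFunctionField).φ n).evalEval W.genX W.genY := by
  rw [evalGeneric_univSpec, UnivEC.map_φ, UnivEC.curve_map_ev (equation_genX_genY W),
    UnivEC.ev_xU, UnivEC.ev_yU]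

/-- `ωₙ(x, y) ∈ K̄(E)`. [folklore] -/
theorem evalGeneric_univSpec_ω (n : ℤ) :
    W.evalGeneric (W.univSpec (UnivEC.ω n)) =
      Affine.Point.ωEval (W.baseChange W.geomFunctionField) W.genX W.genY n := by
  rw [evalGeneric_univSpec]
  rfl

variable [W.IsElliptic]

/-- `ψₘ(x, y) ≠ 0` in `K̄(E)` for `m ≠ 0` (it does not vanish at a non-`m`-torsion point).
[folklore] -/
theorem evalGeneric_univSpec_ψ_ne_zero {m : ℤ} (hm : m ≠ 0) :
    W.evalGeneric (W.univSpec (UnivEC.ψ m)) ≠ 0 := by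
  obtain ⟨P, hP, hP0⟩ := geomPoints.exists_not_mem_of_finite (finite_geomTorsion W hm)
  obtain ⟨a, b, h, rfl⟩ := geomPoints.exists_eq_some hP0
  refine evalGeneric_ne_zero_of_eval_ne_zero (Affine.Point.some_ne_zero h) ?_
  rw [xy_some, eval_univSpec_ψ W m h.1]
  intro h0
  exact hP ((mem_torsionPoints_iff _ _ _).mpr ((Affine.Point.zsmul_some_eq_zero_iff h m).mpr h0))

/-- **`[m](x, y) = ([m]^* x, [m]^* y)`**: the generic image of `[m]` (`Isogeny.genericImage`,
the point `([m]^* x, [m]^* y) ∈ E(K̄(E))`) is `m` times the generic point — the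
multiplication-by-`m` formula (Silverman, *AEC*, Exercise 3.7(d); the tree's
`Affine.Point.zsmul_some_eq_of_evalEval_ψ_ne_zero`) over the field `K̄(E)`.
[cite: SilvermanAEC2009, Exercise 3.7(d)] -/
theorem genericImage_zsmul {m : ℤ} (hm : m ≠ 0) :
    (Isogeny.zsmul W m hm).genericImage = m • W.genericPoint := by
  have hψ : ((W.baseChange W.geomFunctionField).ψ m).evalEval W.genX W.genY ≠ 0 := by
    rw [← evalGeneric_univSpec_ψ]
    exact evalGeneric_univSpec_ψ_ne_zero hm
  obtain ⟨hns, e⟩ := Affine.Point.zsmul_some_eq_of_evalEval_ψ_ne_zero (nonsingular_genX_genY W) hψ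
  rw [genericPoint, e, Isogeny.genericImage]
  simp only [Affine.Point.some.injEq]
  constructor
  · rw [Isogeny.pullbackX_zsmul, evalGeneric_univSpec_φ, evalGeneric_univSpec_ψ]
  · rw [Isogeny.pullbackY_zsmul, evalGeneric_univSpec_ω, evalGeneric_univSpec_ψ]

/-- `[m]^*` maps the generic point to `[m](x, y) = m (x, y)`. [folklore] -/
theorem map_pullbackHom_zsmul_genericPoint {m : ℤ} (hm : m ≠ 0) :
    Affine.Point.map (W' := W) (Isogeny.zsmul W m hm).pullbackHom W.genericPoint =
      m • W.genericPoint := by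
  rw [map_genericPoint, ← genericImage_zsmul hm, Isogeny.genericImage]
  simp only [Isogeny.pullbackHom_genX, Isogeny.pullbackHom_genY]

/-- **`τ_S^* ∘ [m]^* = [m]^* ∘ τ_{mS}^*`** (`[m] ∘ τ_S = τ_{mS} ∘ [m]` on `E`): both `K̄`-algebra
endomorphisms of `K̄(E)` send the generic point to `m (x, y) + m S`. Silverman, *AEC*, III.§4
(`[m]` is a homomorphism), III.3.6. [folklore] -/
theorem transAlgHom_pullbackHom_zsmul {m : ℤ} (hm : m ≠ 0) (S : W.geomPoints)
    (z : W.geomFunctionField) :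
    W.transAlgHom S ((Isogeny.zsmul W m hm).pullbackHom z) =
      (Isogeny.zsmul W m hm).pullbackHom (W.transAlgHom (m • S) z) := by
  have key : (W.transAlgHom S).comp (Isogeny.zsmul W m hm).pullbackHom =
      (Isogeny.zsmul W m hm).pullbackHom.comp (W.transAlgHom (m • S)) := by
    refine algHom_eq_of_map_genericPoint_eq ?_
    rw [← Affine.Point.map_map, map_pullbackHom_zsmul_genericPoint hm, map_zsmul,
      map_transAlgHom_genericPoint, smul_add, ← Affine.Point.map_map,
      map_transAlgHom_genericPoint, map_add, map_pullbackHom_zsmul_genericPoint hm,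
      map_constPoint, map_zsmul]
  exact congrArg (fun φ ↦ φ z) key

end GenericImage

/-! ## `[m]` is unramified: `ord_P ([m]^* u) = ord_{mP} (u)` for every `P` -/

section Unramified

variable [W.IsElliptic]

/-- Re-indexing a product over `E[m]` by an `E[m]`-translation. [folklore] -/
theorem prod_toFinset_torsion_add_left {M : Type*} [CommMonoid M] {m : ℤ} (hm : m ≠ 0)
    {S : W.geomPoints} (hS : m • S = 0) (f : W.geomPoints → M) :
    ∏ R ∈ (finite_geomTorsion W hm).toFinset, f (S + R) =
      ∏ R ∈ (finite_geomTorsion W hm).toFinset, f R := by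
  have hmem : ∀ R : W.geomPoints, R ∈ (finite_geomTorsion W hm).toFinset ↔ m • R = 0 := fun R ↦ by
    rw [Set.Finite.mem_toFinset]
    exact mem_torsionPoints_iff _ _ R
  refine Finset.prod_nbij' (fun R ↦ S + R) (fun R ↦ R - S) ?_ ?_ ?_ ?_ ?_
  · intro R hR
    rw [hmem] at hR ⊢
    rw [smul_add, hS, hR, add_zero]
  · intro R hR
    rw [hmem] at hR ⊢
    rw [smul_sub, hS, hR, sub_zero]
  · intro R _; exact add_sub_cancel_left S R
  · intro R _; exact add_sub_cancel S R
  · intro R _; rfl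

/-- **The norm `N(w) = ∏_{R ∈ E[m]} τ_R^* w` lies in `[m]^* K̄(E)`**: it is fixed by the
translations by `E[m]`, and `K̄(E)^{E[m]} = [m]^* K̄(E)` (the tree's
`Isogeny.pullbackField_zsmul_eq_fixedField`, Silverman *AEC* III.4.10(b)). [folklore] -/
theorem exists_pullbackHom_eq_prod_transAlgHom {m : ℤ} (hm : m ≠ 0) (hmK : (m : K) ≠ 0)
    (w : W.geomFunctionField) :
    ∃ n : W.geomFunctionField, (Isogeny.zsmul W m hm).pullbackHom n =
      ∏ R ∈ (finite_geomTorsion W hm).toFinset, W.transAlgHom R w := by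
  set N := ∏ R ∈ (finite_geomTorsion W hm).toFinset, W.transAlgHom R w with hN
  have hfix : ∀ S : W.geomPoints, m • S = 0 → W.transAlgHom S N = N := fun S hS ↦ by
    rw [hN, map_prod]
    simp_rw [← AlgHom.comp_apply, ← transAlgHom_add]
    exact prod_toFinset_torsion_add_left hm hS fun R ↦ W.transAlgHom R w
  have hmem : N ∈ (Isogeny.zsmul W m hm).pullbackField := by
    rw [Isogeny.pullbackField_zsmul_eq_fixedField hm hmK, IntermediateField.mem_fixedField_iff]
    rintro f hf
    obtain ⟨g, hg, rfl⟩ := Subgroup.mem_map.mp hf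
    rw [transHom_apply]
    exact hfix _ ((mem_torsionPoints_iff _ _ _).mp hg)
  exact ((Isogeny.zsmul W m hm).mem_pullbackField_iff N).mp hmem

/-- A function with a simple zero at `P` and no other zero or pole on the fibre `P + E[m]`
(from `exists_ord_eq_of_pairs` with a generic auxiliary pair of points). [folklore] -/
theorem exists_ord_eq_one_of_fiber {m : ℤ} (hm : m ≠ 0) (P : W.geomPoints) :
    ∃ w : W.geomFunctionField, w ≠ 0 ∧
      ord (W.baseChange (AlgebraicClosure K)).toAffine P w = 1 ∧
      ∀ R : W.geomPoints, m • R = 0 → R ≠ 0 →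
        ord (W.baseChange (AlgebraicClosure K)).toAffine (P + R) w = 0 := by
  have hG := finite_geomTorsion W hm
  -- the translates `P + E[m]` and a generic `P₃ ∉ P + E[m]`
  have hfin₁ : ((fun R ↦ P + R) '' (geomTorsion W m : Set W.geomPoints)).Finite := hG.image _
  obtain ⟨P₃, hP₃, -⟩ := geomPoints.exists_not_mem_of_finite hfin₁
  have hfin₂ : ((fun R ↦ P + R) '' (geomTorsion W m : Set W.geomPoints) ∪
      (fun R ↦ P₃ + R) '' (geomTorsion W m : Set W.geomPoints)).Finite :=
    hfin₁.union (hG.image _)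
  obtain ⟨P₂, hP₂, -⟩ := geomPoints.exists_not_mem_of_finite hfin₂
  rw [Set.mem_union, not_or] at hP₂
  -- membership in a translate of `E[m]`
  have hmemT : ∀ {A Q : W.geomPoints}, Q ∉ (fun R ↦ A + R) '' (geomTorsion W m : Set W.geomPoints) →
      ∀ R : W.geomPoints, m • R = 0 → A + R ≠ Q := by
    intro A Q hQ R hR e
    exact hQ ⟨R, (mem_torsionPoints_iff _ _ R).mpr hR, e⟩
  set P₄ := P + P₂ - P₃ with hP₄
  have hP₄mem : P₄ ∉ (fun R ↦ P + R) '' (geomTorsion W m : Set W.geomPoints) := by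
    rintro ⟨R, hR, e⟩
    apply hP₂.2 ⟨R, hR, ?_⟩
    change P + R = P + P₂ - P₃ at e
    have : P₃ + R = P₂ := by
      have e' := congrArg (· - P + P₃) e
      simp only [add_sub_cancel_left] at e'
      rw [add_comm]; exact e'.trans (by abel)
    exact this
  obtain ⟨w, hw0, hw⟩ := exists_ord_eq_of_pairs (W := W) (Finset.univ : Finset Bool)
    (fun b ↦ cond b P P₂) (fun b ↦ cond b P₃ P₄)
    (by rw [Fintype.sum_bool]; simp only [cond_true, cond_false, hP₄]; abel)
  have hwQ : ∀ Q : W.geomPoints, ord (W.baseChange (AlgebraicClosure K)).toAffine Q w =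
      ((if Q = P then 1 else 0) - (if Q = P₃ then 1 else 0)) +
        ((if Q = P₂ then 1 else 0) - (if Q = P₄ then 1 else 0)) := fun Q ↦ by
    rw [hw Q, Fintype.sum_bool]
    rfl
  refine ⟨w, hw0, ?_, fun R hR hR0 ↦ ?_⟩
  · rw [hwQ, if_pos rfl, if_neg, if_neg, if_neg]
    · ring
    · exact fun e ↦ hmemT hP₄mem 0 (smul_zero _) (by rw [add_zero]; exact e)
    · exact fun e ↦ hmemT hP₂.1 0 (smul_zero _) (by rw [add_zero]; exact e)
    · exact fun e ↦ hmemT hP₃ 0 (smul_zero _) (by rw [add_zero]; exact e)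
  · rw [hwQ, if_neg, if_neg, if_neg, if_neg]
    · ring
    · exact hmemT hP₄mem R hR
    · exact hmemT hP₂.1 R hR
    · exact hmemT hP₃ R hR
    · intro e
      exact hR0 (by simpa using e)

/-- **`[m]` is unramified off `E[m]`**: `ord_P ([m]^* u) = ord_{mP} (u)` for `mP ≠ O`, `m ≠ 0` in
`K`. By `exists_ord_pullbackHom_zsmul`, `ord_P ∘ [m]^* = e · ord_{mP}` with `e ≥ 1`; for `w` with
a simple zero at `P` and no other zero or pole on `P + E[m]`, the norm
`N(w) = ∏_{R ∈ E[m]} τ_R^* w = [m]^* n` (`exists_pullbackHom_eq_prod_transAlgHom`) has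
`ord_P N(w) = Σ_R ord_{P+R} w = 1 = e · ord_{mP} (n)`, so `e = 1`. Silverman, *AEC*,
Thm. III.4.10(c) (a separable isogeny is unramified) for `[m]`, obtained here without the
theory of separability (cf. II.2.6, Ex. 2.2). [cite: SilvermanAEC2009, Thm. III.4.10(c)] -/
theorem ord_pullbackHom_zsmul_of_ne {m : ℤ} (hm : m ≠ 0) (hmK : (m : K) ≠ 0) {P : W.geomPoints}
    (hP : m • P ≠ 0) (u : W.geomFunctionField) :
    ord (W.baseChange (AlgebraicClosure K)).toAffine P ((Isogeny.zsmul W m hm).pullbackHom u) =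
      ord (W.baseChange (AlgebraicClosure K)).toAffine (m • P) u := by
  rcases eq_or_ne u 0 with rfl | hu
  · rw [map_zero]; simp [ord]
  obtain ⟨e, he, hord⟩ := exists_ord_pullbackHom_zsmul hm hP
  -- `e = 1`
  obtain ⟨w, hw0, hwP, hwR⟩ := exists_ord_eq_one_of_fiber hm P
  obtain ⟨n, hn⟩ := exists_pullbackHom_eq_prod_transAlgHom hm hmK w
  have hn0 : n ≠ 0 := by
    rintro rfl
    rw [map_zero, eq_comm] at hn
    exact prod_transAlgHom_ne_zero _ hw0 hn
  have h1 : ord (W.baseChange (AlgebraicClosure K)).toAffine P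
      (∏ R ∈ (finite_geomTorsion W hm).toFinset, W.transAlgHom R w) = 1 := by
    rw [ord_prod_transAlgHom _ hw0, Finset.sum_eq_single (0 : W.geomPoints)]
    · rw [add_zero, hwP]
    · intro R hR hR0
      exact hwR R ((mem_torsionPoints_iff _ _ R).mp ((Set.Finite.mem_toFinset _).mp hR)) hR0
    · intro h0
      exact absurd ((Set.Finite.mem_toFinset _).mpr ((mem_torsionPoints_iff _ _ _).mpr
        (smul_zero m))) h0
  have h2 := hord n hn0
  rw [hn, h1] at h2
  have he1 : (e : ℤ) = 1 := Int.eq_one_of_mul_eq_one_right (by positivity) h2.symm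
  have h3 := hord u hu
  rw [he1, one_mul] at h3
  exact h3

/-- **`[m]` is unramified, also over `O`**: `ord_P ([m]^* u) = ord_{mP} (u)` for every
`P ∈ E(K̄)` (`m ≠ 0` in `K`); for `P ∈ E[m]` translate by a point `S ∉ E[m]` using
`τ_{-S}^* ∘ [m]^* = [m]^* ∘ τ_{-mS}^*` (`transAlgHom_pullbackHom_zsmul`). In particular
`div ([m]^* u) = [m]^* div (u)` with all ramification indices `1`. Silverman, *AEC*,
Thm. III.4.10(c) for `[m]`; Ex. 2.2. [cite: SilvermanAEC2009, Thm. III.4.10(c)] -/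
theorem ord_pullbackHom_zsmul {m : ℤ} (hm : m ≠ 0) (hmK : (m : K) ≠ 0) (P : W.geomPoints)
    (u : W.geomFunctionField) :
    ord (W.baseChange (AlgebraicClosure K)).toAffine P ((Isogeny.zsmul W m hm).pullbackHom u) =
      ord (W.baseChange (AlgebraicClosure K)).toAffine (m • P) u := by
  by_cases hP : m • P ≠ 0
  · exact ord_pullbackHom_zsmul_of_ne hm hmK hP u
  rw [not_not] at hP
  -- choose `S ∉ E[m]`, so that `P + S ∉ E[m]`
  obtain ⟨S, hS, -⟩ := geomPoints.exists_not_mem_of_finite (finite_geomTorsion W hm)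
  have hS' : m • S ≠ 0 := fun h ↦ hS ((mem_torsionPoints_iff _ _ S).mpr h)
  have hPS : m • (P + S) ≠ 0 := by rwa [smul_add, hP, zero_add]
  have key : ord (W.baseChange (AlgebraicClosure K)).toAffine P
      ((Isogeny.zsmul W m hm).pullbackHom u) =
      ord (W.baseChange (AlgebraicClosure K)).toAffine (P + S)
        (W.transAlgHom (-S) ((Isogeny.zsmul W m hm).pullbackHom u)) := by
    rw [ord_transAlgHom, add_neg_cancel_right]
  rw [key, transAlgHom_pullbackHom_zsmul hm, ord_pullbackHom_zsmul_of_ne hm hmK hPS,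
    ord_transAlgHom, smul_add, smul_neg, add_neg_cancel_right, hP]

end Unramified

end WeierstrassCurve
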